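import Literature.AlgebraicGeometry.Morphisms.CechH1
import Literature.AlgebraicGeometry.Limits.SubalgebraStages
import Mathlib.AlgebraicGeometry.Morphisms.Separated
import Literature.AlgebraicGeometry.Morphisms.SeparatedAffinePreimage
import Mathlib.Data.Finset.Lattice.Pi
import Literature.AlgebraicGeometry.Limits.OpenImmersionCriterion
import Mathlib.Order.Filter.AtTopBot.Basic
import Literature.AlgebraicGeometry.Morphisms.ZariskiConnectednessProjectiveAux
import Mathlib.AlgebraicGeometry.Gluing
import Mathlib.AlgebraicGeometry.Cover.MorphismProperty
import Mathlib.RingTheory.Adjoin.FG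
import Mathlib.AlgebraicGeometry.Morphisms.FiniteType
import Literature.AlgebraicGeometry.Modules.IdealSheafNoetherian
import HarnessLib

/-!
# Finite type models of separated schemes of finite type over finitely generated subrings (Stacks 09ZP)

Topic: `Literature/AlgebraicGeometry/Limits` (Noetherian approximation; The Stacks Project, Tags 01ZA,
09ZP, 0A0Q; EGA IV₃ §8; Görtz–Wedhorn I (10.13)–(10.19), Thm. 10.63). **For every separated morphism of
finite type `g : Y → Spec B` there are a finitely generated subring `A₀ = ℤ[t] ⊆ B`, a separated
`A₀`-scheme `Y₀ → Spec A₀` of finite type and a closed `B`-immersion `Y ↪ Y₀ ×_{A₀} Spec B`**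
(`Literature.AlgebraicGeometry.Limits.exists_finiteTypeModel`, at the end of this file). The model `Y₀ = Y_t` is
GLUED (Mathlib `Scheme.IsLocallyDirected`) from the spectra of the subrings `ℤ[t][G S] ⊆ Γ(Y, V_S)`
generated by finitely many sections over the intersections `V_S` of a finite affine open cover of `Y`,
for `t ⊆ B` finite and large. The file has five parts, each with its own synopsis below:

1. the data (nerve `NIdx`, opens `VS`, rings of sections, stage rings `CS`, nerve functor `F`);
2. the facts about `Y` inherited by the stages (generation by separatedness, the families `hfam`,
   localisation identities);
3. good stages: for `t` large `F t` is a locally directed diagram of open immersions;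
4. the model `Y_t = colim (F t)`, the comparison `Ψ : Y → Y_t` and the closed immersion
   `jY : Y → Y_t ×_{ℤ[t]} Spec B`;
5. `Y_t → Spec ℤ[t]` is separated and of finite type over the Noetherian ring `ℤ[t]`; the packaged
   existence theorem.

Everything is proved; the definitions carry unfolding lemmas; no named facts.

## References

* The Stacks Project, Tags 01ZA, 09ZP, 0A0Q (Limits of Schemes). [StacksProject]
* U. Görtz, T. Wedhorn, *Algebraic Geometry I*, 2nd ed. (2020), (10.13), Prop. 9.15, Thm. 10.57,
  Thm. 10.63, Prop. 10.75. [GortzWedhorn2020]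
* A. Grothendieck, J. Dieudonné, EGA IV₃ (1966), Thm. 8.8.2, 8.10.5.
-/

/-!
# Part 1. The data

Topic: `Literature/AlgebraicGeometry/Limits` (Noetherian approximation of schemes of finite type; The
Stacks Project, Tags 01ZA, 09ZP, 0A0Q; EGA IV₃ §8; Görtz–Wedhorn I (10.13)–(10.19)). Let `B` be a ring and
`g : Y → Spec B` a separated `B`-scheme covered by finitely many affine opens `V_1, …, V_n`. This file sets
up the DATA of the finite type models `Y_t` of `Y` over the finitely generated subrings `ℤ[t] ⊆ B`
(`t ⊆ B` finite), in the "scheme-theoretic image" form in which every chart of `Y_t` is the spectrum of a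
SUBRING of the corresponding ring of sections of `Y`:

* `NIdx n` — the nerve of the cover: non-empty subsets `S ⊆ {1, …, n}`, ordered by REVERSE inclusion
  (`S ≤ T ↔ T ⊆ S`, so that `S ≤ T ↔ V_S ⊆ V_T`), with `inter S T = S ∪ T`;
* `VS V S = ⋂_{i ∈ S} V_i` (affine since `Y` is separated, `isAffineOpen_VS`), `C g V S = Γ(Y, V_S)` as a
  `B`-algebra, restrictions `res`;
* `G gen S` — generators of `Γ(Y, V_S)`: the restrictions of chosen generators `gen i` of the `Γ(Y, V_i)`,
  `i ∈ S` (they generate by separatedness, proved in the sequel);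
* `CS gen t S = ℤ[t][G S] ⊆ Γ(Y, V_S)` — the stage rings (`Stage.stage`), the restriction maps
  `resCS` between them, and the **nerve functor** `F gen t : NIdx n ⥤ Scheme`, `S ↦ Spec ℤ[t][G S]`,
  whose colimit (for `t` large, when its transition maps are open immersions) is the model `Y_t`
  (Parts 3–5 below);
* `A t = ℤ[t] ⊆ B` and the structure maps `toCS : ℤ[t] → ℤ[t][G S]`.

Definitions with their unfolding lemmas; no named facts.

## References

* The Stacks Project, Tags 01ZA, 09ZP, 0A0Q (Limits of Schemes). [StacksProject]
* U. Görtz, T. Wedhorn, *Algebraic Geometry I*, 2nd ed. (2020), (10.13), Thm. 10.57, Thm. 10.63.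
  [GortzWedhorn2020]
* A. Grothendieck, J. Dieudonné, EGA IV₃ (1966), Thm. 8.8.2.
-/

noncomputable section

universe u

open CategoryTheory CategoryTheory.Limits AlgebraicGeometry TopologicalSpace Opposite
open Literature.AlgebraicGeometry.Morphisms (Sections algebraMapΓ)

namespace Literature.AlgebraicGeometry.Limits

namespace FTModel

/-! ## The nerve of a finite cover -/

/-- The nerve index: a non-empty subset of the charts. [folklore] -/
structure NIdx (n : ℕ) where
  /-- the set of charts -/
  S : Finset (Fin n)
  /-- non-emptiness -/
  ne : S.Nonempty

namespace NIdx

variable {n : ℕ}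

/-- Indices with the same underlying finite set are equal. [folklore] -/
theorem ext' {S T : NIdx n} (h : S.S = T.S) : S = T := by
  cases S; cases T; cases h; rfl

/-- Reverse inclusion: `S ≤ T ↔ T ⊆ S` (so that `S ≤ T ↔ V_S ⊆ V_T`). [folklore] -/
instance : PartialOrder (NIdx n) :=
  PartialOrder.lift (fun S => OrderDual.toDual S.S) fun _ _ h => ext' (OrderDual.toDual.injective h)

/-- `S ≤ T ↔ T ⊆ S`. [folklore] -/
theorem le_iff {S T : NIdx n} : S ≤ T ↔ T.S ⊆ S.S := Iff.rfl

/-- The nerve is countable. [folklore] -/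
instance : Countable (NIdx n) :=
  Function.Injective.countable (f := fun S : NIdx n => S.S) fun _ _ h => ext' h

/-- The nerve is finite. [folklore] -/
instance : Fintype (NIdx n) :=
  Fintype.ofEquiv {S : Finset (Fin n) // S.Nonempty}
    { toFun := fun S => ⟨S.1, S.2⟩, invFun := fun S => ⟨S.S, S.ne⟩,
      left_inv := fun _ => rfl, right_inv := fun _ => rfl }

/-- The index of `V_S ∩ V_T`: `S ∪ T`. [folklore] -/
def inter (S T : NIdx n) : NIdx n := ⟨S.S ∪ T.S, S.ne.mono Finset.subset_union_left⟩

/-- The underlying set of `inter S T` is `S ∪ T`. [folklore] -/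
@[simp] theorem inter_S (S T : NIdx n) : (inter S T).S = S.S ∪ T.S := rfl

/-- `inter S T ≤ S`. [folklore] -/
theorem inter_le_left (S T : NIdx n) : inter S T ≤ S := by
  rw [le_iff, inter_S]; exact Finset.subset_union_left

/-- `inter S T ≤ T`. [folklore] -/
theorem inter_le_right (S T : NIdx n) : inter S T ≤ T := by
  rw [le_iff, inter_S]; exact Finset.subset_union_right

/-- `inter S T` is the infimum of `S` and `T`. [folklore] -/
theorem le_inter {R S T : NIdx n} (hS : R ≤ S) (hT : R ≤ T) : R ≤ inter S T := by
  rw [le_iff] at hS hT ⊢; rw [inter_S]; exact Finset.union_subset hS hT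

/-- The singleton index of the chart `V_i`. [folklore] -/
def single (i : Fin n) : NIdx n := ⟨{i}, Finset.singleton_nonempty i⟩

/-- The underlying set of `single i` is `{i}`. [folklore] -/
@[simp] theorem single_S (i : Fin n) : (single i).S = {i} := rfl

/-- `S ≤ single i` for `i ∈ S`. [folklore] -/
theorem le_single {S : NIdx n} {i : Fin n} (hi : i ∈ S.S) : S ≤ single i := by
  rw [le_iff, single_S]; exact Finset.singleton_subset_iff.mpr hi

end NIdx

/-! ## The opens `V_S` and their rings of sections -/

section Opens

variable {Y : Scheme.{u}} {n : ℕ} (V : Fin n → Y.affineOpens)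

/-- `V_S = ⋂_{i ∈ S} V_i`. [folklore] -/
def VS (S : NIdx n) : Y.Opens := S.S.inf fun i => (V i : Y.Opens)

/-- `V_S ⊆ V_T` for `S ≤ T`. [folklore] -/
theorem VS_mono {S T : NIdx n} (h : S ≤ T) : VS V S ≤ VS V T :=
  Finset.inf_mono (NIdx.le_iff.mp h)

/-- `V_S ⊆ V_i` for `i ∈ S`. [folklore] -/
theorem VS_le_V {S : NIdx n} {i : Fin n} (hi : i ∈ S.S) : VS V S ≤ (V i : Y.Opens) :=
  Finset.inf_le (f := fun i => (V i : Y.Opens)) hi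

/-- `V_{{i}} = V_i`. [folklore] -/
@[simp] theorem VS_single (i : Fin n) : VS V (NIdx.single i) = (V i : Y.Opens) := by
  simp [VS]

/-- `V_{S ∪ T} = V_S ∩ V_T`. [folklore] -/
theorem VS_inter (S T : NIdx n) : VS V (NIdx.inter S T) = VS V S ⊓ VS V T := by
  simp only [VS, NIdx.inter_S]
  exact Finset.inf_union

/-- A non-empty finite intersection of affine opens of a separated scheme is affine. [folklore] -/
theorem isAffineOpen_finset_inf [Y.IsSeparated] (s : Finset (Fin n)) (hs : s.Nonempty) :
    IsAffineOpen (s.inf fun i => (V i : Y.Opens)) := by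
  classical
  induction s using Finset.induction_on with
  | empty => exact absurd hs (by simp)
  | insert a s ha ih =>
    rw [Finset.inf_insert]
    by_cases hs' : s.Nonempty
    · exact (V a).2.inf (ih hs')
    · rw [Finset.not_nonempty_iff_eq_empty.1 hs', Finset.inf_empty, inf_top_eq]
      exact (V a).2

/-- `V_S` is affine (`Y` separated). [folklore] -/
theorem isAffineOpen_VS [Y.IsSeparated] (S : NIdx n) : IsAffineOpen (VS V S) :=
  isAffineOpen_finset_inf V S.S S.ne

/-- If `Y` is covered by the `V_i` then every point lies in some `V_{single i}`. [folklore] -/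
theorem exists_mem_VS_single (hV : ⨆ i, (V i : Y.Opens) = ⊤) (y : Y) : ∃ i, y ∈ VS V (NIdx.single i) := by
  have : y ∈ (⨆ i, (V i : Y.Opens)) := by rw [hV]; trivial
  obtain ⟨i, hi⟩ := Opens.mem_iSup.mp this
  exact ⟨i, by rwa [VS_single]⟩

end Opens

section Rings

variable {B : Type u} [CommRing B] {Y : Scheme.{u}} (g : Y ⟶ Spec (.of B)) {n : ℕ}
  (V : Fin n → Y.affineOpens)

/-- `C S = Γ(Y, V_S)` as a `B`-algebra. [folklore] -/
abbrev C (S : NIdx n) : Type u := Sections g (VS V S)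

/-- Restriction `Γ(Y, V_T) → Γ(Y, V_S)` for `S ≤ T` (a `B`-algebra homomorphism). [folklore] -/
def res {S T : NIdx n} (h : S ≤ T) : C g V T →ₐ[B] C g V S :=
  Sections.res g (VS_mono V h)

/-- `res` is the restriction map of the structure sheaf. [folklore] -/
theorem res_apply {S T : NIdx n} (h : S ≤ T) (x : C g V T) :
    res g V h x = Y.presheaf.map (homOfLE (VS_mono V h)).op x := rfl

/-- Restriction to the same open is the identity. [folklore] -/
theorem res_self (S : NIdx n) (x : C g V S) : res g V (le_refl S) x = x :=
  Sections.res_self g x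

/-- Restriction is transitive. [folklore] -/
theorem res_res {R S T : NIdx n} (hRS : R ≤ S) (hST : S ≤ T) (x : C g V T) :
    res g V hRS (res g V hST x) = res g V (hRS.trans hST) x :=
  Sections.res_res g _ _ x

/-- Restriction from a chart `V_i ⊇ V_S`. [folklore] -/
def resV {S : NIdx n} {i : Fin n} (hi : i ∈ S.S) : Sections g (V i : Y.Opens) →ₐ[B] C g V S :=
  Sections.res g (VS_le_V V hi)

/-- `resV` is the restriction map of the structure sheaf. [folklore] -/
theorem resV_apply {S : NIdx n} {i : Fin n} (hi : i ∈ S.S) (x : Sections g (V i : Y.Opens)) :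
    resV g V hi x = Y.presheaf.map (homOfLE (VS_le_V V hi)).op x := rfl

/-- Restricting from a chart and then further equals restricting from the chart. [folklore] -/
theorem res_resV {S T : NIdx n} (h : S ≤ T) {i : Fin n} (hi : i ∈ T.S) (x : Sections g (V i : Y.Opens)) :
    res g V h (resV g V hi x) = resV g V (NIdx.le_iff.mp h hi) x :=
  Sections.res_res g _ _ x

/-! ## Generators and stages -/

variable (gen : ∀ i : Fin n, Finset (Sections g (V i : Y.Opens)))

/-- The generators of `Γ(Y, V_S)`: restrictions of the chosen generators of the `Γ(Y, V_i)`, `i ∈ S`.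
[folklore] -/
def G (S : NIdx n) : Set (C g V S) :=
  ⋃ (i : Fin n) (hi : i ∈ S.S), resV g V hi '' (gen i : Set (Sections g (V i : Y.Opens)))

/-- `G S` is finite. [folklore] -/
theorem G_finite (S : NIdx n) : (G g V gen S).Finite := by
  refine Set.finite_iUnion fun i => Set.finite_iUnion fun hi => (Finset.finite_toSet _).image _

/-- Restrictions of chart generators lie in `G S`. [folklore] -/
theorem resV_mem_G {S : NIdx n} {i : Fin n} (hi : i ∈ S.S) {x : Sections g (V i : Y.Opens)}
    (hx : x ∈ gen i) : resV g V hi x ∈ G g V gen S :=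
  Set.mem_iUnion.mpr ⟨i, Set.mem_iUnion.mpr ⟨hi, ⟨x, Finset.mem_coe.mpr hx, rfl⟩⟩⟩

/-- Restriction maps generators into generators. [folklore] -/
theorem res_mem_G {S T : NIdx n} (h : S ≤ T) {x : C g V T} (hx : x ∈ G g V gen T) :
    res g V h x ∈ G g V gen S := by
  obtain ⟨i, hx⟩ := Set.mem_iUnion.mp hx
  obtain ⟨hi, ⟨y, hy, rfl⟩⟩ := Set.mem_iUnion.mp hx
  rw [res_resV]
  exact resV_mem_G g V gen _ (Finset.mem_coe.mp hy)

/-- The stage ring `ℤ[t][G S] ⊆ Γ(Y, V_S)`. [folklore] -/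
def CS (t : Finset B) (S : NIdx n) : Subalgebra ℤ (C g V S) :=
  Stage.stage ℤ t (G g V gen S)

/-- Restriction maps the stage ring of `T` into that of `S ≤ T`. [folklore] -/
theorem res_mem_CS (t : Finset B) {S T : NIdx n} (h : S ≤ T) {x : C g V T} (hx : x ∈ CS g V gen t T) :
    res g V h x ∈ CS g V gen t S :=
  Stage.map_mem_stage (res g V h) (fun _ hx => Stage.subset_stage _ _ (res_mem_G g V gen h hx)) hx

/-- The restriction between stage rings. [folklore] -/
def resCS (t : Finset B) {S T : NIdx n} (h : S ≤ T) : CS g V gen t T →ₐ[ℤ] CS g V gen t S :=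
  (((res g V h).restrictScalars ℤ).comp (CS g V gen t T).val).codRestrict (CS g V gen t S)
    fun x => res_mem_CS g V gen t h x.2

/-- `resCS` is `res` on underlying sections. [folklore] -/
@[simp] theorem coe_resCS (t : Finset B) {S T : NIdx n} (h : S ≤ T) (x : CS g V gen t T) :
    (resCS g V gen t h x : C g V S) = res g V h x := rfl

/-- `resCS` along `S ≤ S` is the identity. [folklore] -/
theorem resCS_self (t : Finset B) (S : NIdx n) (x : CS g V gen t S) : resCS g V gen t (le_refl S) x = x :=
  Subtype.ext (res_self g V S x)

/-- `resCS` is transitive. [folklore] -/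
theorem resCS_resCS (t : Finset B) {R S T : NIdx n} (hRS : R ≤ S) (hST : S ≤ T) (x : CS g V gen t T) :
    resCS g V gen t hRS (resCS g V gen t hST x) = resCS g V gen t (hRS.trans hST) x :=
  Subtype.ext (res_res g V hRS hST x)

/-- **The nerve functor** `S ↦ Spec ℤ[t][G S]`. [folklore] -/
def F (t : Finset B) : NIdx n ⥤ Scheme.{u} where
  obj S := Spec (CommRingCat.of (CS g V gen t S))
  map {S T} f := Spec.map (CommRingCat.ofHom (resCS g V gen t f.le).toRingHom)
  map_id S := by
    have : (resCS g V gen t (𝟙 S).le).toRingHom = RingHom.id _ :=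
      RingHom.ext fun x => resCS_self g V gen t S x
    rw [this, CommRingCat.ofHom_id]
    exact Spec.map_id _
  map_comp {R S T} f h := by
    rw [← Spec.map_comp, ← CommRingCat.ofHom_comp]
    congr 2
    exact RingHom.ext fun x => (resCS_resCS g V gen t f.le h.le x).symm

/-- The nerve functor on objects: `S ↦ Spec ℤ[t][G S]`. [folklore] -/
@[simp] theorem F_obj (t : Finset B) (S : NIdx n) : (F g V gen t).obj S = Spec (CommRingCat.of (CS g V gen t S)) := rfl

/-- The nerve functor on morphisms: `Spec` of the restriction of stage rings. [folklore] -/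
theorem F_map (t : Finset B) {S T : NIdx n} (f : S ⟶ T) :
    (F g V gen t).map f = Spec.map (CommRingCat.ofHom (resCS g V gen t f.le).toRingHom) := rfl

/-! ## The base rings `ℤ[t]` -/

/-- `ℤ[t] ⊆ B`. [folklore] -/
abbrev A (t : Finset B) : Subalgebra ℤ B := Algebra.adjoin ℤ (t : Set B)

/-- The structure scalars from `ℤ[t]` lie in every stage ring. [folklore] -/
theorem algebraMap_mem_CS (t : Finset B) (S : NIdx n) {b : B} (hb : b ∈ A t) :
    algebraMap B (C g V S) b ∈ CS g V gen t S := by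
  have h : (A t).map ((Algebra.ofId B (C g V S)).restrictScalars ℤ) ≤ CS g V gen t S := by
    rw [AlgHom.map_adjoin]
    exact Algebra.adjoin_mono Set.subset_union_left
  exact h ⟨b, hb, rfl⟩

/-- The structure map `ℤ[t] → ℤ[t][G S]`. [folklore] -/
def toCS (t : Finset B) (S : NIdx n) : A t →ₐ[ℤ] CS g V gen t S :=
  ((((Algebra.ofId B (C g V S)).restrictScalars ℤ).comp (A t).val).codRestrict (CS g V gen t S)
    fun b => algebraMap_mem_CS g V gen t S b.2)

/-- `toCS` is the structure map `B → Γ(Y, V_S)` on `ℤ[t]`. [folklore] -/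
@[simp] theorem coe_toCS (t : Finset B) (S : NIdx n) (b : A t) :
    (toCS g V gen t S b : C g V S) = algebraMap B (C g V S) b := rfl

/-- The structure maps `toCS` are compatible with restriction. [folklore] -/
theorem resCS_toCS (t : Finset B) {S T : NIdx n} (h : S ≤ T) (b : A t) :
    resCS g V gen t h (toCS g V gen t T b) = toCS g V gen t S b :=
  Subtype.ext ((res g V h).commutes b)

end Rings

end FTModel

end Literature.AlgebraicGeometry.Limits

end

/-!
# Part 2. The facts about `Y` that the models inherit

Part 2 (the facts about `Y` inherited by the stages). For a separated
`B`-scheme `g : Y → Spec B` with a finite affine open cover `V_1, …, V_n` and chosen `B`-algebra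
generators `gen i` of the `Γ(Y, V_i)`, we record the ring-theoretic facts about the rings of sections
`Γ(Y, V_S)` (`V_S = ⋂_{i ∈ S} V_i`) which, holding in the stage subrings `ℤ[t][G S]` as soon as their
witnesses lie there, make the models work:

* `adjoin_G_eq_top` — **the restrictions of the `gen i`, `i ∈ S`, generate `Γ(Y, V_S)` over `B`**
  (separatedness: `Γ(U) ⊗ Γ(U') → Γ(U ∩ U')` is onto, Görtz–Wedhorn I, Prop. 9.15; the tree's
  `SeparatedAffinePreimage.exists_sum_res_mul_appLE`);
* `exists_d` — `V_i ∩ V_j` is a finite union of basic opens `D(f)`, `f ∈ Γ(Y, V_i)`; `hfam` — for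
  `S ≤ T` (i.e. `V_S ⊆ V_T`) a finite family `h ∈ Γ(Y, V_T)` of products of such `f` with
  `V_S = ⋃ D(h)` (`VS_eq_iSup_basicOpen`), multiplicative along `S ↦ S ∪ S'` (`exists_dvd_of_inter`);
* the localisation facts for `h` with `D(h) ⊆ V_S ⊆ V_T`: `exists_pow_mul_eq_zero` (a section of `V_T`
  vanishing on `V_S` is killed by a power of `h`), `exists_mul_pow_eq_res` (every section of `V_S` times
  a power of `h` extends to `V_T`), `exists_sum_mul_res_eq_one` (the `h` generate the unit ideal of
  `Γ(Y, V_S)`).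

Everything is proved; no named facts.

## References

* U. Görtz, T. Wedhorn, *Algebraic Geometry I*, 2nd ed. (2020), Prop. 9.15, Thm. 2.33 / §(2.11),
  (10.13). [GortzWedhorn2020]
* The Stacks Project, Tags 01ZA, 09ZP. [StacksProject]
-/

noncomputable section

universe u

open CategoryTheory CategoryTheory.Limits AlgebraicGeometry TopologicalSpace Opposite
open Literature.AlgebraicGeometry.Morphisms (Sections algebraMapΓ)

namespace Literature.AlgebraicGeometry.Limits

namespace FTModel

set_option backward.isDefEq.respectTransparency false

variable {B : Type u} [CommRing B] {Y : Scheme.{u}} (g : Y ⟶ Spec (.of B)) {n : ℕ}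
  (V : Fin n → Y.affineOpens) (gen : ∀ i : Fin n, Finset (Sections g (V i : Y.Opens)))

/-! ## Generalities on restriction -/

omit gen in
/-- Restriction maps of the structure sheaf between the same opens agree. [folklore] -/
theorem presheaf_map_eq {U W : Y.Opens} (i j : op U ⟶ op W) (x : Γ(Y, U)) :
    Y.presheaf.map i x = Y.presheaf.map j x := by
  rw [Subsingleton.elim i j]

omit gen in
/-- Composite restrictions. [folklore] -/
theorem presheaf_map_map {U W W' : Y.Opens} (i : op U ⟶ op W) (j : op W ⟶ op W') (k : op U ⟶ op W')
    (x : Γ(Y, U)) : Y.presheaf.map j (Y.presheaf.map i x) = Y.presheaf.map k x := by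
  rw [← CommRingCat.comp_apply, ← Functor.map_comp, Subsingleton.elim (i ≫ j) k]

omit gen in
/-- Restriction along an equality of opens and back is the identity. [folklore] -/
theorem presheaf_map_map_self {U W : Y.Opens} (i : op U ⟶ op W) (j : op W ⟶ op U) (x : Γ(Y, U)) :
    Y.presheaf.map j (Y.presheaf.map i x) = x := by
  rw [presheaf_map_map (k := 𝟙 _), CategoryTheory.Functor.map_id]; rfl

/-! ## The generators generate -/

section Generate

variable (hgen : ∀ i, Algebra.adjoin B (↑(gen i) : Set (Sections g (V i : Y.Opens))) = ⊤)

omit gen in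
/-- `Γ(Y, V_{{i}}) = Γ(Y, V_i)`: restriction from the chart is onto. [folklore] -/
theorem resV_single_surjective (i : Fin n) :
    Function.Surjective (resV g V (S := NIdx.single i) (Finset.mem_singleton_self i)) := by
  intro y
  have e : (V i : Y.Opens) ≤ VS V (NIdx.single i) := (VS_single V i).ge
  refine ⟨Y.presheaf.map (homOfLE e).op y, ?_⟩
  rw [resV_apply]
  exact presheaf_map_map_self _ _ y

include hgen in
/-- The base case: `Γ(Y, V_{{i}})` is generated by the (restricted) `gen i`. [folklore] -/
theorem adjoin_G_single (i : Fin n) : Algebra.adjoin B (G g V gen (NIdx.single i)) = ⊤ := by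
  have hi : i ∈ (NIdx.single i).S := Finset.mem_singleton_self i
  have h1 : Algebra.adjoin B (resV g V hi '' (↑(gen i) : Set (Sections g (V i : Y.Opens)))) ≤
      Algebra.adjoin B (G g V gen (NIdx.single i)) :=
    Algebra.adjoin_mono fun x ⟨y, hy, hxy⟩ => hxy ▸ resV_mem_G g V gen hi (Finset.mem_coe.mp hy)
  rw [← AlgHom.map_adjoin, hgen i, Algebra.map_top] at h1
  refine top_le_iff.mp fun y _ => h1 ?_
  obtain ⟨x, rfl⟩ := resV_single_surjective g V i y
  exact ⟨x, rfl⟩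

include hgen in
/-- **The inductive step**: if the generators generate `Γ(Y, V_T)` then they generate
`Γ(Y, V_{{a} ∪ T}) = Γ(Y, V_a ∩ V_T)`, by the separatedness of `Y` over `Spec B`
(`Γ(V_a) ⊗_B Γ(V_T) → Γ(V_a ∩ V_T)` is onto). [cite: GortzWedhorn2020, Prop. 9.15 (pp. 234–235)] -/
theorem adjoin_G_inter_single [IsSeparated g] (a : Fin n) (T : NIdx n)
    (hT : Algebra.adjoin B (G g V gen T) = ⊤) :
    Algebra.adjoin B (G g V gen (NIdx.inter (NIdx.single a) T)) = ⊤ := by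
  classical
  haveI : Y.IsSeparated := by
    constructor
    rw [← terminal.comp_from g]
    infer_instance
  set S := NIdx.inter (NIdx.single a) T with hS
  have ha : a ∈ S.S := by simp [hS]
  have hle : S ≤ T := NIdx.inter_le_right _ _
  have e : VS V S = (V a : Y.Opens) ⊓ VS V T := by rw [hS, VS_inter, VS_single]
  refine top_le_iff.mp fun c _ => ?_
  -- transport `c` to `Γ(Y, V_a ∩ V_T)` and decompose it
  obtain ⟨F, hF⟩ := Morphisms.SeparatedAffinePreimage.exists_sum_res_mul_appLE (𝟙 Y) g (V a).2
    (isAffineOpen_VS V T) (Y.presheaf.map (eqToHom e.symm).op c)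
  have hc : c = Y.presheaf.map (eqToHom e).op (Y.presheaf.map (eqToHom e.symm).op c) :=
    (presheaf_map_map_self _ _ c).symm
  rw [hF, map_sum] at hc
  rw [hc]
  refine Subalgebra.sum_mem _ fun st _ => ?_
  rw [map_mul]
  refine Subalgebra.mul_mem _ ?_ ?_
  · -- the `Γ(V_a)` factor
    have h1 : Y.presheaf.map (eqToHom e).op (Y.presheaf.map (homOfLE (inf_le_left :
        (V a : Y.Opens) ⊓ (𝟙 Y) ⁻¹ᵁ VS V T ≤ V a)).op st.1) = resV g V ha st.1 := by
      rw [resV_apply]; exact presheaf_map_map _ _ _ _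
    rw [h1]
    have hmem : (show Sections g (V a : Y.Opens) from st.1) ∈
        Algebra.adjoin B (↑(gen a) : Set (Sections g (V a : Y.Opens))) := by
      rw [hgen]; exact Algebra.mem_top
    have h2 : (Algebra.adjoin B (↑(gen a) : Set (Sections g (V a : Y.Opens)))).map (resV g V ha) ≤
        Algebra.adjoin B (G g V gen S) := by
      rw [AlgHom.map_adjoin]
      exact Algebra.adjoin_mono fun x ⟨y, hy, hxy⟩ => hxy ▸ resV_mem_G g V gen ha (Finset.mem_coe.mp hy)
    exact h2 ⟨_, hmem, rfl⟩
  · -- the `Γ(V_T)` factor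
    have h1 : Y.presheaf.map (eqToHom e).op (Scheme.Hom.appLE (𝟙 Y) (VS V T)
        ((V a : Y.Opens) ⊓ (𝟙 Y) ⁻¹ᵁ VS V T) inf_le_right st.2) = res g V hle st.2 := by
      rw [res_apply]
      change Y.presheaf.map (eqToHom e).op (((𝟙 Y :).app (VS V T) ≫
        Y.presheaf.map (homOfLE (inf_le_right : (V a : Y.Opens) ⊓ (𝟙 Y) ⁻¹ᵁ VS V T ≤ _)).op) st.2) = _
      rw [Scheme.Hom.id_app, Category.id_comp]
      exact presheaf_map_map _ _ _ _
    rw [h1]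
    have hmem : (show C g V T from st.2) ∈ Algebra.adjoin B (G g V gen T) := by rw [hT]; exact Algebra.mem_top
    have h2 : (Algebra.adjoin B (G g V gen T)).map (res g V hle) ≤ Algebra.adjoin B (G g V gen S) := by
      rw [AlgHom.map_adjoin]
      exact Algebra.adjoin_mono fun x ⟨y, hy, hxy⟩ => hxy ▸ res_mem_G g V gen hle hy
    exact h2 ⟨_, hmem, rfl⟩

include hgen in
/-- **The restrictions of the chart generators generate `Γ(Y, V_S)` over `B`** for every `S`
(induction on `S`, `adjoin_G_single`, `adjoin_G_inter_single`). [cite: GortzWedhorn2020, Prop. 9.15 (pp. 234–235)] -/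
theorem adjoin_G_eq_top [IsSeparated g] (S : NIdx n) : Algebra.adjoin B (G g V gen S) = ⊤ := by
  suffices H : ∀ (s : Finset (Fin n)) (hs : s.Nonempty), Algebra.adjoin B (G g V gen ⟨s, hs⟩) = ⊤ from
    H S.S S.ne
  intro s hs
  induction hs using Finset.Nonempty.cons_induction with
  | singleton a => exact adjoin_G_single g V gen hgen a
  | cons a s h hs ih =>
    have e : (⟨Finset.cons a s h, Finset.cons_nonempty h⟩ : NIdx n) = NIdx.inter (NIdx.single a) ⟨s, hs⟩ :=
      NIdx.ext' (show Finset.cons a s h = {a} ∪ s by rw [Finset.cons_eq_insert, Finset.insert_eq])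
    rw [e]
    exact adjoin_G_inter_single g V gen hgen a ⟨s, hs⟩ ih

end Generate

/-! ## Basic opens: products and restrictions -/

omit gen in
/-- `U ∩ D(∏ f_i) = U ∩ ⋂ D(f_i)` for finitely many sections over an open `U' ⊇ U`-… (here all over the
same open `U`): `U ⊓ s.inf D(f) = D(∏_{i ∈ s} f_i)`. [folklore] -/
theorem basicOpen_prod_eq {U : Y.Opens} {ι : Type*} (s : Finset ι) (f : ι → Γ(Y, U)) :
    Y.basicOpen (∏ i ∈ s, f i) = U ⊓ s.inf fun i => Y.basicOpen (f i) := by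
  classical
  induction s using Finset.induction_on with
  | empty => rw [Finset.prod_empty, Finset.inf_empty, inf_top_eq, Scheme.basicOpen_one]
  | insert a s ha ih =>
    rw [Finset.prod_insert ha, Scheme.basicOpen_mul, ih, Finset.inf_insert, inf_left_comm]

/-! ## `V_i ∩ V_j` as a finite union of basic opens of `V_i` -/

omit gen in
/-- **`V_i ∩ V_j = ⋃_{f ∈ d} D(f)` for a finite `d ⊆ Γ(Y, V_i)`** (`V_i ∩ V_j` is a quasi-compact open of
the affine `V_i`; basic opens form a basis). [cite: GortzWedhorn2020, Thm. 2.33 / §(2.11)] -/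
theorem exists_d [Y.IsSeparated] (i j : Fin n) :
    ∃ d : Finset Γ(Y, (V i : Y.Opens)), (V i : Y.Opens) ⊓ V j = d.sup fun f => Y.basicOpen f := by
  classical
  set W : Y.Opens := (V i : Y.Opens) ⊓ V j with hW
  have hWc : IsCompact (W : Set Y) := ((V i).2.inf (V j).2).isCompact
  have hex : ∀ x : W, ∃ f : Γ(Y, (V i : Y.Opens)), Y.basicOpen f ≤ W ∧ (x : Y) ∈ Y.basicOpen f :=
    fun x => (V i).2.exists_basicOpen_le x (show (x : Y) ∈ (V i : Y.Opens) from x.2.1)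
  choose f hfW hxf using hex
  obtain ⟨t, ht⟩ := hWc.elim_finite_subcover (fun x : W => (Y.basicOpen (f x) : Set Y))
    (fun x => (Y.basicOpen (f x)).isOpen) fun x hx => Set.mem_iUnion.mpr ⟨⟨x, hx⟩, hxf ⟨x, hx⟩⟩
  refine ⟨t.image f, le_antisymm ?_ ?_⟩
  · intro x hx
    obtain ⟨y, hy⟩ := Set.mem_iUnion.mp (ht hx)
    obtain ⟨hyt, hxy⟩ := Set.mem_iUnion.mp hy
    have hle : Y.basicOpen (f y) ≤ (t.image f).sup fun f => Y.basicOpen f :=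
      Finset.le_sup (f := fun f => Y.basicOpen f) (Finset.mem_image_of_mem f hyt)
    exact hle hxy
  · exact Finset.sup_le fun g hg => by
      obtain ⟨y, -, rfl⟩ := Finset.mem_image.mp hg
      exact hfW y

/-! ## The families `h` with `V_S = ⋃ D(h)`, `h ∈ Γ(Y, V_T)` -/

section HFam

variable (d : ∀ i j : Fin n, Finset Γ(Y, (V i : Y.Opens)))

omit gen in
/-- A chosen chart containing `V_T`. [folklore] -/
def i₀ (T : NIdx n) : Fin n := T.ne.choose

omit gen in
/-- The chosen chart index of `T` lies in `T`. [folklore] -/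
theorem i₀_mem (T : NIdx n) : i₀ T ∈ T.S := T.ne.choose_spec

/-- Extension of a partial choice function by `1`. [folklore] -/
def ext (T : NIdx n) (s : Finset (Fin n)) (φ : ∀ j ∈ s, Γ(Y, (V (i₀ T) : Y.Opens))) (j : Fin n) :
    Γ(Y, (V (i₀ T) : Y.Opens)) :=
  if h : j ∈ s then φ j h else 1

omit gen in
/-- `ext` extends the given family on `s`. [folklore] -/
theorem ext_of_mem (T : NIdx n) (s : Finset (Fin n)) (φ : ∀ j ∈ s, Γ(Y, (V (i₀ T) : Y.Opens))) {j : Fin n}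
    (h : j ∈ s) : ext V T s φ j = φ j h := dif_pos h

/-- **The family `hfam S T ⊆ Γ(Y, V_T)`**: restrictions to `V_T` of the products `∏_{j ∈ S} φ_j`,
`φ_j ∈ d_{i₀ j}`. [folklore] -/
def hfam (S T : NIdx n) : Finset (C g V T) := by
  classical
  exact (S.S.pi fun j => d (i₀ T) j).image fun φ =>
    resV g V (i₀_mem T) (show Sections g (V (i₀ T) : Y.Opens) from ∏ j ∈ S.S, ext V T S.S φ j)

omit gen in
/-- Lattice identity: `V_S = V_T ∩ ⋂_{j ∈ S} (V_{i₀} ∩ V_j)` for `S ≤ T`. [folklore] -/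
theorem VS_eq_inf_inf {S T : NIdx n} (hST : S ≤ T) :
    VS V S = VS V T ⊓ S.S.inf fun j => (V (i₀ T) : Y.Opens) ⊓ V j := by
  apply le_antisymm
  · refine le_inf (VS_mono V hST) (Finset.le_inf fun j hj => le_inf ?_ (VS_le_V V hj))
    exact (VS_mono V hST).trans (VS_le_V V (i₀_mem T))
  · refine Finset.le_inf fun j hj => ?_
    exact inf_le_right.trans ((Finset.inf_le hj).trans inf_le_right)

/-- **`V_S = ⋃_{h ∈ hfam S T} D(h)`** for `S ≤ T`, given `V_{i₀} ∩ V_j = ⋃_{f ∈ d_{i₀ j}} D(f)`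
(finite distributivity in the lattice of opens). [folklore] -/
theorem VS_eq_sup_hfam (hd : ∀ i j, (V i : Y.Opens) ⊓ V j = (d i j).sup fun f => Y.basicOpen f)
    {S T : NIdx n} (hST : S ≤ T) :
    VS V S = (hfam g V d S T).sup fun h => Y.basicOpen (h : Γ(Y, VS V T)) := by
  classical
  rw [VS_eq_inf_inf V hST]
  have e1 : (S.S.inf fun j => (V (i₀ T) : Y.Opens) ⊓ V j) =
      S.S.inf fun j => (d (i₀ T) j).sup fun f => Y.basicOpen f := Finset.inf_congr rfl fun j _ => hd _ _
  rw [e1, Finset.inf_sup, Finset.sup_inf_distrib_left, hfam, Finset.sup_image]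
  refine Finset.sup_congr rfl fun φ _ => ?_
  have hT : VS V T ≤ (V (i₀ T) : Y.Opens) := VS_le_V V (i₀_mem T)
  rw [Function.comp_apply, resV_apply, Scheme.basicOpen_res, basicOpen_prod_eq, ← inf_assoc,
    inf_eq_left.mpr hT, ← Finset.inf_attach (s := S.S) (f := fun i => Y.basicOpen (ext V T S.S φ i))]
  congr 1
  exact Finset.inf_congr rfl fun j _ => by rw [ext_of_mem V T S.S φ j.2]

/-- Each `D(h)`, `h ∈ hfam S T`, is contained in `V_S`. [folklore] -/
theorem basicOpen_le_VS (hd : ∀ i j, (V i : Y.Opens) ⊓ V j = (d i j).sup fun f => Y.basicOpen f)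
    {S T : NIdx n} (hST : S ≤ T) {h : C g V T} (hh : h ∈ hfam g V d S T) :
    Y.basicOpen (h : Γ(Y, VS V T)) ≤ VS V S := by
  rw [VS_eq_sup_hfam g V d hd hST]
  exact Finset.le_sup (f := fun h => Y.basicOpen (h : Γ(Y, VS V T))) hh

/-- **Multiplicativity along `S ↦ S ∪ S'`**: for `h₁ ∈ hfam S₁ T`, `h₂ ∈ hfam S₂ T` there is
`h ∈ hfam (S₁ ∪ S₂) T` dividing `h₁ h₂`. [folklore] -/
theorem exists_dvd_of_inter {S₁ S₂ T : NIdx n} {h₁ h₂ : C g V T} (hh₁ : h₁ ∈ hfam g V d S₁ T)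
    (hh₂ : h₂ ∈ hfam g V d S₂ T) : ∃ h ∈ hfam g V d (NIdx.inter S₁ S₂) T, h ∣ h₁ * h₂ := by
  classical
  obtain ⟨φ₁, hφ₁, rfl⟩ := Finset.mem_image.mp hh₁
  obtain ⟨φ₂, hφ₂, rfl⟩ := Finset.mem_image.mp hh₂
  -- the combined choice function
  let χ : ∀ j ∈ (NIdx.inter S₁ S₂).S, Γ(Y, (V (i₀ T) : Y.Opens)) := fun j hj =>
    if h : j ∈ S₁.S then φ₁ j h else φ₂ j ((Finset.mem_union.mp hj).resolve_left h)
  have hχ : χ ∈ (NIdx.inter S₁ S₂).S.pi fun j => d (i₀ T) j := by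
    rw [Finset.mem_pi]
    intro j hj
    by_cases h : j ∈ S₁.S
    · simp only [χ, dif_pos h]; exact Finset.mem_pi.mp hφ₁ j h
    · simp only [χ, dif_neg h]; exact Finset.mem_pi.mp hφ₂ j _
  refine ⟨_, Finset.mem_image.mpr ⟨χ, hχ, rfl⟩, ?_⟩
  rw [← map_mul]
  refine map_dvd (resV g V (i₀_mem T)) ?_
  -- `∏_{S₁ ∪ S₂} χ = ∏_{S₁} φ₁ · ∏_{S₂ \ S₁} φ₂ ∣ ∏_{S₁} φ₁ · ∏_{S₂} φ₂`
  change (∏ j ∈ (NIdx.inter S₁ S₂).S, ext V T (NIdx.inter S₁ S₂).S χ j) ∣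
    (∏ j ∈ S₁.S, ext V T S₁.S φ₁ j) * ∏ j ∈ S₂.S, ext V T S₂.S φ₂ j
  have e1 : (NIdx.inter S₁ S₂).S = S₁.S ∪ (S₂.S \ S₁.S) := by
    rw [NIdx.inter_S, Finset.union_sdiff_self_eq_union]
  rw [Finset.prod_congr e1 (fun _ _ => rfl), Finset.prod_union Finset.disjoint_sdiff]
  refine mul_dvd_mul ?_ ?_
  · refine Finset.prod_dvd_prod_of_dvd _ _ fun j hj => ?_
    rw [ext_of_mem V T _ χ (Finset.mem_union_left _ hj), ext_of_mem V T _ φ₁ hj]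
    simp only [χ, dif_pos hj]; rfl
  · refine dvd_trans (Finset.prod_dvd_prod_of_dvd _ _ fun j hj => ?_)
      (Finset.prod_dvd_prod_of_subset _ _ _ Finset.sdiff_subset)
    obtain ⟨hj₂, hj₁⟩ := Finset.mem_sdiff.mp hj
    rw [ext_of_mem V T _ χ (Finset.mem_union_right _ hj₂), ext_of_mem V T _ φ₂ hj₂]
    simp only [χ, dif_neg hj₁]; rfl

/-- The restrictions to `V_T` of all the `f ∈ d_{i₀(T) j}`: the `h ∈ hfam S T` are products of these.
[folklore] -/
def dres (T : NIdx n) : Set (C g V T) :=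
  ⋃ j : Fin n, (fun x : Γ(Y, (V (i₀ T) : Y.Opens)) => resV g V (i₀_mem T) x) '' (↑(d (i₀ T) j) : Set Γ(Y, (V (i₀ T) : Y.Opens)))

/-- `dres T` is finite. [folklore] -/
theorem dres_finite (T : NIdx n) : (dres g V d T).Finite :=
  Set.finite_iUnion fun _ => (Finset.finite_toSet _).image _

/-- Restrictions of products of `ext φ` lie in the monoid generated by `dres T`. [folklore] -/
theorem resV_prod_ext_mem_closure (T : NIdx n) (s : Finset (Fin n))
    {φ : ∀ j ∈ s, Γ(Y, (V (i₀ T) : Y.Opens))} (hφ : φ ∈ s.pi fun j => d (i₀ T) j) (s' : Finset (Fin n)) :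
    resV g V (i₀_mem T) (show Sections g (V (i₀ T) : Y.Opens) from ∏ j ∈ s', ext V T s φ j) ∈
      Submonoid.closure (dres g V d T) := by
  rw [map_prod]
  refine prod_mem fun j _ => ?_
  by_cases hj : j ∈ s
  · rw [ext_of_mem V T s φ hj]
    exact Submonoid.subset_closure (Set.mem_iUnion.mpr ⟨j, ⟨φ j hj, Finset.mem_pi.mp hφ j hj, rfl⟩⟩)
  · have : ext V T s φ j = 1 := dif_neg hj
    rw [this, map_one]
    exact one_mem _

/-- The `h ∈ hfam S T` lie in the monoid generated by `dres T`. [folklore] -/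
theorem hfam_subset_closure (S T : NIdx n) : (↑(hfam g V d S T) : Set (C g V T)) ⊆ Submonoid.closure (dres g V d T) := by
  classical
  intro h hh
  obtain ⟨φ, hφ, rfl⟩ := Finset.mem_image.mp (Finset.mem_coe.mp hh)
  exact resV_prod_ext_mem_closure g V d T S.S hφ S.S

/-- **Multiplicativity with an explicit cofactor**: for `h₁ ∈ hfam S₁ T`, `h₂ ∈ hfam S₂ T` there are
`h ∈ hfam (S₁ ∪ S₂) T` and `c` in the monoid generated by `dres T` with `h₁ h₂ = h c`. [folklore] -/
theorem exists_mul_eq_of_inter {S₁ S₂ T : NIdx n} {h₁ h₂ : C g V T} (hh₁ : h₁ ∈ hfam g V d S₁ T)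
    (hh₂ : h₂ ∈ hfam g V d S₂ T) :
    ∃ h ∈ hfam g V d (NIdx.inter S₁ S₂) T, ∃ c ∈ Submonoid.closure (dres g V d T), h₁ * h₂ = h * c := by
  classical
  obtain ⟨φ₁, hφ₁, rfl⟩ := Finset.mem_image.mp hh₁
  obtain ⟨φ₂, hφ₂, rfl⟩ := Finset.mem_image.mp hh₂
  let χ : ∀ j ∈ (NIdx.inter S₁ S₂).S, Γ(Y, (V (i₀ T) : Y.Opens)) := fun j hj =>
    if h : j ∈ S₁.S then φ₁ j h else φ₂ j ((Finset.mem_union.mp hj).resolve_left h)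
  have hχ : χ ∈ (NIdx.inter S₁ S₂).S.pi fun j => d (i₀ T) j := by
    rw [Finset.mem_pi]
    intro j hj
    by_cases h : j ∈ S₁.S
    · simp only [χ, dif_pos h]; exact Finset.mem_pi.mp hφ₁ j h
    · simp only [χ, dif_neg h]; exact Finset.mem_pi.mp hφ₂ j _
  refine ⟨_, Finset.mem_image.mpr ⟨χ, hχ, rfl⟩, _,
    resV_prod_ext_mem_closure g V d T S₂.S hφ₂ (S₂.S ∩ S₁.S), ?_⟩
  rw [← map_mul, ← map_mul]
  congr 1
  change (∏ j ∈ S₁.S, ext V T S₁.S φ₁ j) * ∏ j ∈ S₂.S, ext V T S₂.S φ₂ j =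
    (∏ j ∈ (NIdx.inter S₁ S₂).S, ext V T (NIdx.inter S₁ S₂).S χ j) * ∏ j ∈ S₂.S ∩ S₁.S, ext V T S₂.S φ₂ j
  have e1 : (NIdx.inter S₁ S₂).S = S₁.S ∪ (S₂.S \ S₁.S) := by
    rw [NIdx.inter_S, Finset.union_sdiff_self_eq_union]
  rw [Finset.prod_congr e1 (fun _ _ => rfl), Finset.prod_union Finset.disjoint_sdiff]
  have e2 : ∏ j ∈ S₁.S, ext V T (NIdx.inter S₁ S₂).S χ j = ∏ j ∈ S₁.S, ext V T S₁.S φ₁ j :=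
    Finset.prod_congr rfl fun j hj => by
      rw [ext_of_mem V T _ χ (Finset.mem_union_left _ hj), ext_of_mem V T _ φ₁ hj]
      simp only [χ, dif_pos hj]
  have e3 : ∏ j ∈ S₂.S \ S₁.S, ext V T (NIdx.inter S₁ S₂).S χ j = ∏ j ∈ S₂.S \ S₁.S, ext V T S₂.S φ₂ j :=
    Finset.prod_congr rfl fun j hj => by
      obtain ⟨hj₂, hj₁⟩ := Finset.mem_sdiff.mp hj
      rw [ext_of_mem V T _ χ (Finset.mem_union_right _ hj₂), ext_of_mem V T _ φ₂ hj₂]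
      simp only [χ, dif_neg hj₁]
  rw [e2, e3, mul_assoc, ← Finset.prod_union (Finset.disjoint_sdiff_inter S₂.S S₁.S),
    Finset.sdiff_union_inter]

end HFam

/-! ## Localisation facts for `D(h) ⊆ V_S ⊆ V_T` -/

section Loc

variable {S T : NIdx n} (hST : S ≤ T) (h : Γ(Y, VS V T)) (hD : Y.basicOpen h ≤ VS V S)

omit gen in
include hD in
/-- **A section of `V_T` vanishing on `V_S` is killed by a power of `h`** (`Γ(Y, D(h))` is the
localisation of `Γ(Y, V_T)` at `h`, `V_T` affine). [cite: GortzWedhorn2020, Thm. 2.33 (p. 59)] -/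
theorem exists_pow_mul_eq_zero [Y.IsSeparated] {a : Γ(Y, VS V T)}
    (ha : Y.presheaf.map (homOfLE (VS_mono V hST)).op a = 0) : ∃ k : ℕ, h ^ k * a = 0 := by
  haveI := (isAffineOpen_VS V T).isLocalization_basicOpen h
  have h0 : algebraMap Γ(Y, VS V T) Γ(Y, Y.basicOpen h) a = 0 := by
    rw [RingHom.algebraMap_toAlgebra]
    change Y.presheaf.map _ a = 0
    rw [← presheaf_map_map (i := (homOfLE (VS_mono V hST)).op) (j := (homOfLE hD).op), ha, map_zero]
  obtain ⟨⟨m, k, rfl⟩, hm⟩ := (IsLocalization.map_eq_zero_iff (Submonoid.powers h) _ a).mp h0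
  exact ⟨k, hm⟩

omit gen in
include hD in
/-- **Every section of `V_S` times a power of `h` extends to `V_T`**: for `x ∈ Γ(Y, V_S)` there are
`N` and `c ∈ Γ(Y, V_T)` with `x · h^N = c|_{V_S}` (surjectivity of `Γ(V_T)[1/h] → Γ(D(h))` and
injectivity of `Γ(V_S)[1/h] → Γ(D(h))`). [cite: GortzWedhorn2020, Thm. 2.33 (p. 59)] -/
theorem exists_mul_pow_eq_res [Y.IsSeparated] (x : Γ(Y, VS V S)) :
    ∃ (N : ℕ) (c : Γ(Y, VS V T)), x * Y.presheaf.map (homOfLE (VS_mono V hST)).op h ^ N =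
      Y.presheaf.map (homOfLE (VS_mono V hST)).op c := by
  set hS : Γ(Y, VS V S) := Y.presheaf.map (homOfLE (VS_mono V hST)).op h with hhS
  haveI := (isAffineOpen_VS V T).isLocalization_basicOpen h
  -- surjectivity on the `T` side
  obtain ⟨⟨c, ⟨m, N, rfl⟩⟩, hc⟩ := IsLocalization.surj (Submonoid.powers h)
    (Y.presheaf.map (homOfLE hD).op x : Γ(Y, Y.basicOpen h))
  -- `y = x h^N - c|` vanishes on `D(h)`
  set y : Γ(Y, VS V S) := x * hS ^ N - Y.presheaf.map (homOfLE (VS_mono V hST)).op c with hy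
  have hy0 : Y.presheaf.map (homOfLE hD).op y = 0 := by
    simp only [hy, hhS, map_sub, map_mul, map_pow]
    rw [presheaf_map_map (k := (homOfLE (Y.basicOpen_le _)).op),
      presheaf_map_map (k := (homOfLE (Y.basicOpen_le _)).op), sub_eq_zero]
    have hc' := hc
    simp only [map_pow] at hc'
    rw [RingHom.algebraMap_toAlgebra] at hc'
    exact hc'
  -- injectivity on the `S` side
  haveI := (isAffineOpen_VS V S).isLocalization_basicOpen hS
  have hle : Y.basicOpen hS ≤ Y.basicOpen h := by
    rw [hhS, Scheme.basicOpen_res]; exact inf_le_right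
  have hy0' : algebraMap Γ(Y, VS V S) Γ(Y, Y.basicOpen hS) y = 0 := by
    rw [RingHom.algebraMap_toAlgebra]
    change Y.presheaf.map _ y = 0
    rw [← presheaf_map_map (i := (homOfLE hD).op) (j := (homOfLE hle).op), hy0, map_zero]
  obtain ⟨⟨m', k, rfl⟩, hk⟩ := (IsLocalization.map_eq_zero_iff (Submonoid.powers hS) _ y).mp hy0'
  refine ⟨N + k, h ^ k * c, ?_⟩
  have hk' : hS ^ k * (x * hS ^ N - Y.presheaf.map (homOfLE (VS_mono V hST)).op c) = 0 := hk
  rw [map_mul, map_pow, pow_add]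
  linear_combination hk'

/-- **The `h ∈ hfam S T` generate the unit ideal of `Γ(Y, V_S)`** (`V_S = ⋃ D(h)` and `V_S` is affine):
explicit coefficients. [cite: GortzWedhorn2020, Thm. 2.33 / §(2.11)] -/
theorem exists_sum_mul_res_eq_one [Y.IsSeparated] (d : ∀ i j : Fin n, Finset Γ(Y, (V i : Y.Opens)))
    (hd : ∀ i j, (V i : Y.Opens) ⊓ V j = (d i j).sup fun f => Y.basicOpen f) :
    ∃ a : hfam g V d S T → C g V S, ∑ f, a f * res g V hST f.1 = 1 := by
  classical
  have hspan : Ideal.span (Set.range fun f : hfam g V d S T =>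
      (Y.presheaf.map (homOfLE (VS_mono V hST)).op (f.1 : Γ(Y, VS V T)) : Γ(Y, VS V S))) = ⊤ := by
    rw [← (isAffineOpen_VS V S).self_le_iSup_basicOpen_iff]
    intro x hx
    have hx' : x ∈ (hfam g V d S T).sup fun h => Y.basicOpen (h : Γ(Y, VS V T)) := by
      rwa [← VS_eq_sup_hfam g V d hd hST]
    rw [Finset.sup_eq_iSup] at hx'
    obtain ⟨f, hf⟩ := Opens.mem_iSup.mp hx'
    obtain ⟨hf, hxf⟩ := Opens.mem_iSup.mp hf
    refine Opens.mem_iSup.mpr ⟨⟨_, ⟨⟨f, hf⟩, rfl⟩⟩, ?_⟩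
    change x ∈ Y.basicOpen (Y.presheaf.map (homOfLE (VS_mono V hST)).op (f : Γ(Y, VS V T)))
    rw [Scheme.basicOpen_res]
    exact ⟨hx, hxf⟩
  have h1 : (1 : Γ(Y, VS V S)) ∈ Ideal.span (Set.range fun f : hfam g V d S T =>
      (Y.presheaf.map (homOfLE (VS_mono V hST)).op (f.1 : Γ(Y, VS V T)) : Γ(Y, VS V S))) := by
    rw [hspan]; trivial
  exact Ideal.mem_span_range_iff_exists_fun.mp h1

end Loc

end FTModel

end Literature.AlgebraicGeometry.Limits

end

/-!
# Part 3. For `t` large the nerve functor is a locally directed diagram of open immersions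

Part 3 (good stages). For a
separated `B`-scheme `g : Y → Spec B` with a finite affine open cover `V_i` and generators `gen i` of the
`Γ(Y, V_i)`, the stage rings `ℤ[t][G S] ⊆ Γ(Y, V_S)` and the nerve functor `F t : S ↦ Spec ℤ[t][G S]` of
Part 1 have, for all finite `t ⊆ B` containing some `t₀`:

* `eventually_isOpenImmersion_map` — **every transition map `Spec ℤ[t][G S] → Spec ℤ[t][G T]` (`S ≤ T`,
  i.e. `V_S ⊆ V_T`) is an open immersion with image `⋃_{h ∈ hfam S T} D(h)`**: the finitely many witnesses
  of the identities of Part 2 (which make `Γ(V_T)[1/h] → Γ(V_S)[1/h]` bijective and the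
  `h` generate the unit ideal of `Γ(V_S)`) lie in the stages, where the identities then hold because the
  stages are subrings (`SubalgebraStages`), and the ring-theoretic criterion
  `SpecOpenImmersion.isOpenImmersion_specMap` applies;
* `eventually_good` — all of this simultaneously for all `S ≤ T` (the nerve is finite);
* `isLocallyDirected_of_good` — **the diagram is then locally directed** (Mathlib's hypothesis for gluing
  along it): points of `Spec ℤ[t][G S₁]` and `Spec ℤ[t][G S₂]` with the same image in `Spec ℤ[t][G T]` come
  from `Spec ℤ[t][G (S₁ ∪ S₂)]`, because `D(h₁) ∩ D(h₂) ⊆ D(h)` for the `h ∈ hfam (S₁ ∪ S₂) T` dividing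
  `h₁ h₂` (`exists_dvd_of_inter`).

This is the heart of the existence of the finite type models `Y_t = colim F t`
(Part 4): The Stacks Project, Tag 01ZA-type
approximation in scheme-theoretic image form. Everything is proved; no named facts.

## References

* The Stacks Project, Tags 01ZA, 09ZP, 0A0Q (Limits of Schemes). [StacksProject]
* U. Görtz, T. Wedhorn, *Algebraic Geometry I*, 2nd ed. (2020), (10.13), Thm. 10.57, Thm. 10.63.
  [GortzWedhorn2020]
-/

noncomputable section

universe u

open CategoryTheory CategoryTheory.Limits AlgebraicGeometry TopologicalSpace Opposite Filter
open Literature.AlgebraicGeometry.Morphisms (Sections algebraMapΓ)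

namespace Literature.AlgebraicGeometry.Limits

namespace FTModel

set_option backward.isDefEq.respectTransparency false

variable {B : Type u} [CommRing B] {Y : Scheme.{u}} (g : Y ⟶ Spec (.of B)) {n : ℕ}
  (V : Fin n → Y.affineOpens) (gen : ∀ i : Fin n, Finset (Sections g (V i : Y.Opens)))
  (d : ∀ i j : Fin n, Finset Γ(Y, (V i : Y.Opens)))
  (hgen : ∀ i, Algebra.adjoin B (↑(gen i) : Set (Sections g (V i : Y.Opens))) = ⊤)
  (hd : ∀ i j, (V i : Y.Opens) ⊓ V j = (d i j).sup fun f => Y.basicOpen f)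

omit gen d in
/-- `Y` is separated (absolutely) when `g` is. [folklore] -/
theorem isSeparated_of [IsSeparated g] : Y.IsSeparated := by
  constructor
  rw [← terminal.comp_from g]
  infer_instance

/-! ## Eventual membership in the stages -/

include hgen in
/-- Every section of `V_S` lies in the stage `ℤ[t][G S]` for `t` large. [folklore] -/
theorem eventually_mem_CS [IsSeparated g] (S : NIdx n) (x : C g V S) :
    ∀ᶠ t in atTop, x ∈ CS g V gen t S := by
  obtain ⟨t₀, ht₀⟩ := Stage.exists_forall_mem_stage (K := ℤ) (adjoin_G_eq_top g V gen hgen S) x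
  exact eventually_atTop.mpr ⟨t₀, fun t ht => ht₀ t ht⟩

include hgen in
/-- Finitely many sections of `V_S` lie in the stage for `t` large. [folklore] -/
theorem eventually_forall_mem_CS [IsSeparated g] (S : NIdx n) {ι : Type*} [Finite ι] (x : ι → C g V S) :
    ∀ᶠ t in atTop, ∀ i, x i ∈ CS g V gen t S :=
  eventually_all.mpr fun i => eventually_mem_CS g V gen hgen S (x i)

/-! ## The transition maps are eventually open immersions -/

section Pair

variable {S T : NIdx n} (hST : S ≤ T)

include hgen hd in
/-- **Eventually the awayMap witnesses lie in the stages**: for `h ∈ hfam S T` and `t` large, `h ∈ ℤ[t][G T]`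
and every `x ∈ ℤ[t][G S]` satisfies `x · h^N = c|_{V_S}` with `c ∈ ℤ[t][G T]`. [folklore] -/
theorem eventually_witness [IsSeparated g] (f : hfam g V d S T) :
    ∀ᶠ t in atTop, (f.1 : C g V T) ∈ CS g V gen t T ∧
      ∀ x ∈ CS g V gen t S, ∃ (N : ℕ) (c : C g V T), c ∈ CS g V gen t T ∧
        x * res g V hST f.1 ^ N = res g V hST c := by
  haveI := isSeparated_of g
  have hD := basicOpen_le_VS g V d hd hST f.2
  have hw : ∀ x ∈ G g V gen S, ∃ (N : ℕ) (c : C g V T), x * res g V hST f.1 ^ N = res g V hST c :=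
    fun x _ => exists_mul_pow_eq_res V hST (f.1 : Γ(Y, VS V T)) hD x
  obtain ⟨t₀, ht₀⟩ := Stage.exists_forall_away_witness (K := ℤ) (res g V hST) (G_finite g V gen S)
    (adjoin_G_eq_top g V gen hgen T) (f.1 : C g V T) hw
  refine eventually_atTop.mpr ⟨t₀, fun t ht => ?_⟩
  obtain ⟨hh, hx⟩ := ht₀ t ht
  exact ⟨hh, fun x hx' => by
    obtain ⟨N, c, hc, hxc⟩ := hx x hx'
    exact ⟨N, c, hc, hxc⟩⟩

include hgen hd in
/-- **For `t` large, `Spec ℤ[t][G S] → Spec ℤ[t][G T]` is an open immersion with image `⋃ D(h)`,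
`h ∈ hfam S T`.** [cite: GortzWedhorn2020, Thm. 10.63 (p. 327), in scheme-theoretic image form] -/
theorem eventually_isOpenImmersion_map [IsSeparated g] :
    ∀ᶠ t in atTop, ∃ hmem : ∀ f : hfam g V d S T, (f.1 : C g V T) ∈ CS g V gen t T,
      IsOpenImmersion ((F g V gen t).map (homOfLE hST)) ∧
        Set.range ((F g V gen t).map (homOfLE hST)) =
          ⋃ f : hfam g V d S T, (PrimeSpectrum.basicOpen (⟨f.1, hmem f⟩ : CS g V gen t T) : Set (PrimeSpectrum (CS g V gen t T))) := by
  classical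
  haveI := isSeparated_of g
  -- coefficients of `Σ a_h h|_{V_S} = 1`
  obtain ⟨a, ha⟩ := exists_sum_mul_res_eq_one g V hST d hd (S := S) (T := T)
  have E2 := eventually_forall_mem_CS g V gen hgen S a
  have E3 : ∀ᶠ t in atTop, ∀ f : hfam g V d S T, (f.1 : C g V T) ∈ CS g V gen t T ∧
      ∀ x ∈ CS g V gen t S, ∃ (N : ℕ) (c : C g V T), c ∈ CS g V gen t T ∧
        x * res g V hST f.1 ^ N = res g V hST c :=
    eventually_all.mpr fun f => eventually_witness g V gen d hgen hd hST f
  filter_upwards [E2, E3] with t hE2 hE3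
  refine ⟨fun f => (hE3 f).1, ?_⟩
  -- the ring-theoretic criterion
  let ψ : CS g V gen t T →+* CS g V gen t S := (resCS g V gen t hST).toRingHom
  let hh : hfam g V d S T → CS g V gen t T := fun f => ⟨f.1, (hE3 f).1⟩
  have hspan : Ideal.span (Set.range fun f => ψ (hh f)) = ⊤ := by
    rw [Ideal.eq_top_iff_one]
    refine Ideal.mem_span_range_iff_exists_fun.mpr ⟨fun f => ⟨a f, hE2 f⟩, Subtype.ext ?_⟩
    rw [AddSubmonoidClass.coe_finsetSum, OneMemClass.coe_one, ← ha]
    refine Finset.sum_congr rfl fun f _ => ?_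
    rw [MulMemClass.coe_mul]
    rfl
  have hbij : ∀ f, Function.Bijective (Localization.awayMap ψ (hh f)) := fun f => by
    refine ⟨Localization.awayMap_injective_iff.mpr ?_, Localization.awayMap_surjective_iff.mpr ?_⟩
    · intro b hb
      have hb' : Y.presheaf.map (homOfLE (VS_mono V hST)).op (b.1 : C g V T) = 0 :=
        congrArg Subtype.val hb
      obtain ⟨k, hk⟩ := exists_pow_mul_eq_zero V hST (f.1 : Γ(Y, VS V T))
        (basicOpen_le_VS g V d hd hST f.2) hb'
      exact ⟨k, Subtype.ext hk⟩
    · intro x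
      obtain ⟨N, c, hc, hxc⟩ := (hE3 f).2 x.1 x.2
      refine ⟨⟨c, hc⟩, N, Subtype.ext ?_⟩
      change res g V hST c = ((ψ (hh f) ^ N * x : CS g V gen t S) : C g V S)
      rw [MulMemClass.coe_mul, SubmonoidClass.coe_pow, ← hxc, mul_comm]
      rfl
  exact ⟨SpecOpenImmersion.isOpenImmersion_specMap ψ hh hspan hbij,
    SpecOpenImmersion.range_specMap ψ hh hbij hspan⟩

end Pair

/-! ## Everything at once, and local directedness -/

include hgen in
/-- The `dres T` lie in the stages for `t` large. [folklore] -/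
theorem eventually_dres_subset [IsSeparated g] (T : NIdx n) : ∀ᶠ t in atTop, dres g V d T ⊆ CS g V gen t T := by
  haveI := (dres_finite g V d T).to_subtype
  have := eventually_forall_mem_CS g V gen hgen T (fun x : dres g V d T => (x : C g V T))
  filter_upwards [this] with t ht
  exact fun x hx => ht ⟨x, hx⟩

include hgen hd in
/-- **The good stages**: for all finite `t ⊆ B` containing some `t₀`, all restricted `d`-elements lie in
the stages and every transition map of the nerve functor `F t` is an open immersion with image `⋃ D(h)`.
[cite: GortzWedhorn2020, Thm. 10.63 (p. 327), in scheme-theoretic image form] -/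
theorem eventually_good [IsSeparated g] :
    ∀ᶠ t in atTop, (∀ T, dres g V d T ⊆ CS g V gen t T) ∧
      ∀ (S T : NIdx n) (hST : S ≤ T), ∃ hmem : ∀ f : hfam g V d S T, (f.1 : C g V T) ∈ CS g V gen t T,
        IsOpenImmersion ((F g V gen t).map (homOfLE hST)) ∧
          Set.range ((F g V gen t).map (homOfLE hST)) =
            ⋃ f : hfam g V d S T, (PrimeSpectrum.basicOpen (⟨f.1, hmem f⟩ : CS g V gen t T) :
              Set (PrimeSpectrum (CS g V gen t T))) := by
  have h1 : ∀ᶠ t in atTop, ∀ T, dres g V d T ⊆ CS g V gen t T :=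
    eventually_all.mpr fun T => eventually_dres_subset g V gen d hgen T
  have h2 : ∀ᶠ t in atTop, ∀ p : {p : NIdx n × NIdx n // p.1 ≤ p.2},
      ∃ hmem : ∀ f : hfam g V d p.1.1 p.1.2, (f.1 : C g V p.1.2) ∈ CS g V gen t p.1.2,
        IsOpenImmersion ((F g V gen t).map (homOfLE p.2)) ∧
          Set.range ((F g V gen t).map (homOfLE p.2)) =
            ⋃ f : hfam g V d p.1.1 p.1.2, (PrimeSpectrum.basicOpen (⟨f.1, hmem f⟩ : CS g V gen t p.1.2) :
              Set (PrimeSpectrum (CS g V gen t p.1.2))) :=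
    eventually_all.mpr fun p => eventually_isOpenImmersion_map g V gen d hgen hd p.2
  filter_upwards [h1, h2] with t ht1 ht2
  exact ⟨ht1, fun S T hST => ht2 ⟨(S, T), hST⟩⟩

omit hgen hd in
/-- **At a good stage the nerve functor is locally directed**: points of `Spec ℤ[t][G S₁]` and
`Spec ℤ[t][G S₂]` with the same image `p` in `Spec ℤ[t][G T]` come from a point of `Spec ℤ[t][G (S₁ ∪ S₂)]`:
`p ∈ D(h₁) ∩ D(h₂) ⊆ D(h)` for the `h ∈ hfam (S₁ ∪ S₂) T` with `h₁ h₂ = h c` (`exists_mul_eq_of_inter`),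
and `D(h)` lies in the image of `Spec ℤ[t][G (S₁ ∪ S₂)]`; the transition maps being injective, the
preimages match. [folklore] -/
theorem isLocallyDirected_of_good (t : Finset B) (hdres : ∀ T, dres g V d T ⊆ CS g V gen t T)
    (hgood : ∀ (S T : NIdx n) (hST : S ≤ T), ∃ hmem : ∀ f : hfam g V d S T, (f.1 : C g V T) ∈ CS g V gen t T,
        IsOpenImmersion ((F g V gen t).map (homOfLE hST)) ∧
          Set.range ((F g V gen t).map (homOfLE hST)) =
            ⋃ f : hfam g V d S T, (PrimeSpectrum.basicOpen (⟨f.1, hmem f⟩ : CS g V gen t T) :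
              Set (PrimeSpectrum (CS g V gen t T)))) :
    ((F g V gen t) ⋙ Scheme.forget).IsLocallyDirected := by
  constructor
  intro S₁ S₂ T fi fj x₁ x₂ hx
  change (F g V gen t).map fi x₁ = (F g V gen t).map fj x₂ at hx
  obtain ⟨hmem₁, hOI₁, hr₁⟩ := hgood S₁ T fi.le
  obtain ⟨hmem₂, hOI₂, hr₂⟩ := hgood S₂ T fj.le
  rw [Subsingleton.elim (homOfLE fi.le) fi] at hOI₁ hr₁
  rw [Subsingleton.elim (homOfLE fj.le) fj] at hOI₂ hr₂
  have hle : NIdx.inter S₁ S₂ ≤ T := (NIdx.inter_le_left S₁ S₂).trans fi.le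
  obtain ⟨hmem, -, hr⟩ := hgood (NIdx.inter S₁ S₂) T hle
  -- `p ∈ D(h₁) ∩ D(h₂)`
  have hp₁ : (F g V gen t).map fi x₁ ∈ Set.range ((F g V gen t).map fi) := ⟨x₁, rfl⟩
  have hp₂ : (F g V gen t).map fi x₁ ∈ Set.range ((F g V gen t).map fj) := ⟨x₂, hx.symm⟩
  rw [hr₁] at hp₁
  rw [hr₂] at hp₂
  obtain ⟨f₁, hf₁⟩ := Set.mem_iUnion.mp hp₁
  obtain ⟨f₂, hf₂⟩ := Set.mem_iUnion.mp hp₂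
  -- `h ∈ hfam (S₁ ∪ S₂) T` with `h₁ h₂ = h c`
  obtain ⟨h, hh, c, hc, heq⟩ := exists_mul_eq_of_inter g V d f₁.2 f₂.2
  have hcmem : c ∈ CS g V gen t T :=
    (Submonoid.closure_le (S := (CS g V gen t T).toSubsemiring.toSubmonoid)).mpr (hdres T) hc
  have key : (F g V gen t).map fi x₁ ∈ (PrimeSpectrum.basicOpen (⟨h, hmem ⟨h, hh⟩⟩ : CS g V gen t T) :
      Set (PrimeSpectrum (CS g V gen t T))) := by
    have e : (⟨f₁.1, hmem₁ f₁⟩ * ⟨f₂.1, hmem₂ f₂⟩ : CS g V gen t T) = ⟨h, hmem ⟨h, hh⟩⟩ * ⟨c, hcmem⟩ :=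
      Subtype.ext heq
    have hle' : PrimeSpectrum.basicOpen (⟨f₁.1, hmem₁ f₁⟩ : CS g V gen t T) ⊓
        PrimeSpectrum.basicOpen (⟨f₂.1, hmem₂ f₂⟩ : CS g V gen t T) ≤
          PrimeSpectrum.basicOpen (⟨h, hmem ⟨h, hh⟩⟩ : CS g V gen t T) := by
      rw [← PrimeSpectrum.basicOpen_mul, e, PrimeSpectrum.basicOpen_mul]; exact inf_le_left
    exact hle' ⟨hf₁, hf₂⟩
  -- hence `p` comes from `Spec ℤ[t][G (S₁ ∪ S₂)]`
  have hp : (F g V gen t).map fi x₁ ∈ Set.range ((F g V gen t).map (homOfLE hle)) := by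
    rw [hr]; exact Set.mem_iUnion.mpr ⟨⟨h, hh⟩, key⟩
  obtain ⟨x, hx'⟩ := hp
  haveI := hOI₁
  haveI := hOI₂
  refine ⟨NIdx.inter S₁ S₂, homOfLE (NIdx.inter_le_left S₁ S₂), homOfLE (NIdx.inter_le_right S₁ S₂), x, ?_, ?_⟩
  · change (F g V gen t).map (homOfLE (NIdx.inter_le_left S₁ S₂)) x = x₁
    apply ((F g V gen t).map fi).isOpenEmbedding.injective
    rw [← Scheme.Hom.comp_apply, ← Functor.map_comp,
      Subsingleton.elim (homOfLE (NIdx.inter_le_left S₁ S₂) ≫ fi) (homOfLE hle), hx']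
  · change (F g V gen t).map (homOfLE (NIdx.inter_le_right S₁ S₂)) x = x₂
    apply ((F g V gen t).map fj).isOpenEmbedding.injective
    rw [← Scheme.Hom.comp_apply, ← Functor.map_comp,
      Subsingleton.elim (homOfLE (NIdx.inter_le_right S₁ S₂) ≫ fj) (homOfLE hle), hx', hx]

end FTModel

end Literature.AlgebraicGeometry.Limits

end

/-!
# Part 4. The model `Y_t` and `Y ↪ Y_t ×_{ℤ[t]} Spec B`

Part 4 (the model). At a good stage
`t` (`FTModel.eventually_good`) the nerve functor `F t : S ↦ Spec ℤ[t][G S]` is a locally directed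
diagram of open immersions, so Mathlib glues it (`Scheme.IsLocallyDirected`, `colimit (F t)`): this is
the **model `Y_t`** of the separated `B`-scheme `Y` over the finitely generated subring `ℤ[t] ⊆ B`. We
construct

* `u S : V_S → Spec ℤ[t][G S]` (through `Spec Γ(Y, V_S)`), natural in `S`; `ψ S = u S ≫ ι_S : V_S → Y_t`;
* `Ψ : Y → Y_t`, glued from the `ψ` over the charts (`Scheme.Cover.glueMorphisms`), with
  `V_S.ι ≫ Ψ = ψ S` and `Ψ⁻¹(U_S) = V_S` where `U_S ⊆ Y_t` is the image of `Spec ℤ[t][G S]`;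
* the structure map `pt : Y_t → Spec ℤ[t]` and the compatibility `Ψ ≫ pt = g ≫ (Spec B → Spec ℤ[t])`;
* `jY : Y → Y_t ×_{ℤ[t]} Spec B` — **a closed immersion over `B`** (`isClosedImmersion_jY`): over the
  affine chart `Spec ℤ[t][G S] ×_{ℤ[t]} Spec B` of the target its source is the affine `V_S` and the ring
  map is onto, `Γ(Y, V_S)` being generated by `G S ⊆ ℤ[t][G S]` over `B`.

This is The Stacks Project, Tags 01ZA/09ZP (a scheme of finite type over `B = colim ℤ[t]` is a closed
subscheme of the base change of a scheme of finite type over some `ℤ[t]`) in scheme-theoretic image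
form. Everything is proved; no named facts.

## References

* The Stacks Project, Tags 01ZA, 09ZP, 0A0Q (Limits of Schemes). [StacksProject]
* U. Görtz, T. Wedhorn, *Algebraic Geometry I*, 2nd ed. (2020), (10.13), Thm. 10.57, Thm. 10.63, Prop. 10.75.
  [GortzWedhorn2020]
* A. Grothendieck, J. Dieudonné, EGA IV₃ (1966), Thm. 8.8.2, 8.10.5.
-/

noncomputable section

universe u

open CategoryTheory CategoryTheory.Limits AlgebraicGeometry TopologicalSpace Opposite
open Literature.AlgebraicGeometry.Morphisms (Sections algebraMapΓ)

namespace Literature.AlgebraicGeometry.Limits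

namespace FTModel

set_option backward.isDefEq.respectTransparency false

variable {B : Type u} [CommRing B] {Y : Scheme.{u}} (g : Y ⟶ Spec (.of B)) {n : ℕ}
  (V : Fin n → Y.affineOpens) (gen : ∀ i : Fin n, Finset (Sections g (V i : Y.Opens)))
  (t : Finset B)

/-! ## The comparison maps `u_S : V_S → Spec ℤ[t][G S]` -/

/-- `u_S : V_S → Spec Γ(Y, V_S) → Spec ℤ[t][G S]`. [folklore] -/
def u (S : NIdx n) : (VS V S).toScheme ⟶ (F g V gen t).obj S :=
  (VS V S).toSpecΓ ≫ Spec.map (CommRingCat.ofHom (CS g V gen t S).val.toRingHom)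

/-- **Naturality of `u`**: `u_S ≫ (Spec ℤ[t][G S] → Spec ℤ[t][G T]) = (V_S ⊆ V_T) ≫ u_T`. [folklore] -/
theorem u_naturality {S T : NIdx n} (f : S ⟶ T) :
    u g V gen t S ≫ (F g V gen t).map f = Y.homOfLE (VS_mono V f.le) ≫ u g V gen t T := by
  have e : (CommRingCat.ofHom (resCS g V gen t f.le).toRingHom ≫
      CommRingCat.ofHom (CS g V gen t S).val.toRingHom) =
      CommRingCat.ofHom (CS g V gen t T).val.toRingHom ≫ Y.presheaf.map (homOfLE (VS_mono V f.le)).op := by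
    ext x; rfl
  rw [u, u, F_map, Category.assoc, ← Spec.map_comp, e, Spec.map_comp, ← Category.assoc,
    Scheme.Opens.toSpecΓ_SpecMap_presheaf_map, Category.assoc]

/-- The preimage of `D(x)`, `x ∈ ℤ[t][G S]`, under `u_S` is `D(x) ⊆ V_S`. [folklore] -/
theorem u_preimage_basicOpen (S : NIdx n) (x : CommRingCat.of (CS g V gen t S)) :
    u g V gen t S ⁻¹ᵁ PrimeSpectrum.basicOpen x = (VS V S).ι ⁻¹ᵁ Y.basicOpen (x.1 : Γ(Y, VS V S)) := by
  rw [u, Scheme.Hom.comp_preimage]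
  change (VS V S).toSpecΓ ⁻¹ᵁ (Spec.map _ ⁻¹ᵁ PrimeSpectrum.basicOpen x) = _
  rw [AlgebraicGeometry.SpecMap_preimage_basicOpen, Scheme.Opens.toSpecΓ_preimage_basicOpen]
  rfl

/-! ## The model `Y_t` at a good stage -/

section Model

variable [hOI : ∀ {S T : NIdx n} (f : S ⟶ T), IsOpenImmersion ((F g V gen t).map f)]
  [hLD : ((F g V gen t) ⋙ Scheme.forget).IsLocallyDirected]

/-- `ψ_S = u_S ≫ ι_S : V_S → Y_t = colim F t`. [folklore] -/
def ψ (S : NIdx n) : (VS V S).toScheme ⟶ colimit (F g V gen t) :=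
  u g V gen t S ≫ colimit.ι (F g V gen t) S

/-- Naturality of `ψ`. [folklore] -/
theorem homOfLE_ψ {S T : NIdx n} (h : S ≤ T) :
    Y.homOfLE (VS_mono V h) ≫ ψ g V gen t T = ψ g V gen t S := by
  rw [ψ, ψ, ← Category.assoc, ← u_naturality g V gen t (homOfLE h), Category.assoc, colimit.w]

variable (hV : ⨆ i, (V i : Y.Opens) = ⊤)

omit gen t in
/-- The open cover of `Y` by the charts `V_{{i}}`. [folklore] -/
def chartCover : Y.OpenCover :=
  Scheme.Cover.mkOfCovers (Fin n) (fun i => (VS V (NIdx.single i)).toScheme) (fun i => (VS V (NIdx.single i)).ι)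
    fun y => by
      obtain ⟨i, hi⟩ := exists_mem_VS_single V hV y
      exact ⟨i, ⟨y, hi⟩, rfl⟩

omit gen t in
/-- The maps of the chart cover are the inclusions `V_{{i}} ⊆ Y`. [folklore] -/
@[simp] theorem chartCover_f (i : Fin n) : (chartCover V hV).f i = (VS V (NIdx.single i)).ι := rfl

/-- **`Ψ : Y → Y_t`**, glued from the `ψ_{{i}}` over the charts. [folklore] -/
def Ψ : Y ⟶ colimit (F g V gen t) :=
  Scheme.Cover.glueMorphisms (chartCover V hV) (fun i => ψ g V gen t (NIdx.single i)) fun i j => by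
    -- compare on `V_i ∩ V_j = V_{{i,j}}`
    set W := VS V (NIdx.inter (NIdx.single i) (NIdx.single j)) with hW
    have hWi : W ≤ VS V (NIdx.single i) := VS_mono V (NIdx.inter_le_left _ _)
    have hWj : W ≤ VS V (NIdx.single j) := VS_mono V (NIdx.inter_le_right _ _)
    have hrange : Set.range (pullback.fst ((chartCover V hV).f i) ((chartCover V hV).f j) ≫
        (VS V (NIdx.single i)).ι) = Set.range W.ι := by
      rw [Scheme.Opens.range_ι, hW, VS_inter]
      ext x
      constructor
      · rintro ⟨z, rfl⟩
        refine ⟨(pullback.fst ((chartCover V hV).f i) ((chartCover V hV).f j) z).2, ?_⟩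
        rw [Scheme.Hom.comp_apply]
        change ((pullback.fst ((chartCover V hV).f i) ((chartCover V hV).f j) ≫ (chartCover V hV).f i) z) ∈
          (VS V (NIdx.single j) : Set Y)
        rw [pullback.condition, Scheme.Hom.comp_apply]
        exact (pullback.snd ((chartCover V hV).f i) ((chartCover V hV).f j) z).2
      · rintro ⟨hxi, hxj⟩
        obtain ⟨z, hz, -⟩ := Scheme.Pullback.exists_preimage_pullback (f := (chartCover V hV).f i)
          (g := (chartCover V hV).f j) ⟨x, hxi⟩ ⟨x, hxj⟩ rfl
        exact ⟨z, by rw [Scheme.Hom.comp_apply, hz]; rfl⟩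
    let e := IsOpenImmersion.isoOfRangeEq _ _ hrange
    have he : e.hom ≫ W.ι = pullback.fst _ _ ≫ (VS V (NIdx.single i)).ι :=
      IsOpenImmersion.isoOfRangeEq_hom_fac _ _ hrange
    have h1 : e.inv ≫ pullback.fst ((chartCover V hV).f i) ((chartCover V hV).f j) = Y.homOfLE hWi := by
      rw [← cancel_mono (VS V (NIdx.single i)).ι, Category.assoc, ← he, Iso.inv_hom_id_assoc,
        Scheme.homOfLE_ι]
    have h2 : e.inv ≫ pullback.snd ((chartCover V hV).f i) ((chartCover V hV).f j) = Y.homOfLE hWj := by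
      rw [← cancel_mono (VS V (NIdx.single j)).ι, Category.assoc, Scheme.homOfLE_ι]
      change e.inv ≫ pullback.snd ((chartCover V hV).f i) ((chartCover V hV).f j) ≫ (chartCover V hV).f j = W.ι
      rw [← pullback.condition, ← Category.assoc, h1]
      exact Scheme.homOfLE_ι _ _
    rw [← cancel_epi e.inv, ← Category.assoc, ← Category.assoc, h1, h2,
      homOfLE_ψ g V gen t (NIdx.inter_le_left _ _), homOfLE_ψ g V gen t (NIdx.inter_le_right _ _)]

/-- `V_{{i}}.ι ≫ Ψ = ψ_{{i}}`. [folklore] -/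
theorem ι_Ψ_single (i : Fin n) : (VS V (NIdx.single i)).ι ≫ Ψ g V gen t hV = ψ g V gen t (NIdx.single i) :=
  Scheme.Cover.ι_glueMorphisms (chartCover V hV) _ _ i

/-- **`V_S.ι ≫ Ψ = ψ_S`** for every `S`. [folklore] -/
theorem ι_Ψ (S : NIdx n) : (VS V S).ι ≫ Ψ g V gen t hV = ψ g V gen t S := by
  obtain ⟨i, hi⟩ := S.ne
  have h : S ≤ NIdx.single i := NIdx.le_single hi
  rw [← Scheme.homOfLE_ι Y (VS_mono V h), Category.assoc, ι_Ψ_single, homOfLE_ψ g V gen t h]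

/-! ## `Ψ⁻¹(U_S) = V_S` -/

/-- Points of `V_S` map into the chart `U_S = im (Spec ℤ[t][G S] → Y_t)`. [folklore] -/
theorem Ψ_apply_mem (S : NIdx n) {y : Y} (hy : y ∈ VS V S) :
    Ψ g V gen t hV y ∈ (colimit.ι (F g V gen t) S).opensRange := by
  have h := congrArg (fun φ => φ ⟨y, hy⟩) (congrArg (fun φ : (VS V S).toScheme ⟶ _ => (φ : _ → _)) (ι_Ψ g V gen t hV S))
  simp only [Scheme.Hom.comp_base, TopCat.coe_comp, Function.comp_apply] at h
  change Ψ g V gen t hV y = (u g V gen t S ≫ colimit.ι (F g V gen t) S) ⟨y, hy⟩ at h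
  rw [h, Scheme.Hom.comp_apply]
  exact ⟨_, rfl⟩

/-! ## The structure map `Y_t → Spec ℤ[t]` and `jY : Y → Y_t ×_{ℤ[t]} Spec B` -/

/-- The structure map `pt : Y_t → Spec ℤ[t]`, from the `Spec ℤ[t][G S] → Spec ℤ[t]`. [folklore] -/
def pt : colimit (F g V gen t) ⟶ Spec (CommRingCat.of (A t)) :=
  colimit.desc (F g V gen t)
    { pt := Spec (CommRingCat.of (A t))
      ι := { app := fun S => Spec.map (CommRingCat.ofHom (toCS g V gen t S).toRingHom)
             naturality := fun S T f => by
               change (F g V gen t).map f ≫ Spec.map _ = Spec.map _ ≫ 𝟙 _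
               rw [Category.comp_id, F_map, ← Spec.map_comp]
               congr 1
               ext b
               exact congrArg Subtype.val (resCS_toCS g V gen t f.le b) } }

/-- The chart `U_S → Y_t → Spec ℤ[t]` is `Spec` of the structure map `ℤ[t] → ℤ[t][G S]`. [folklore] -/
@[simp] theorem ι_pt (S : NIdx n) :
    colimit.ι (F g V gen t) S ≫ pt g V gen t = Spec.map (CommRingCat.ofHom (toCS g V gen t S).toRingHom) :=
  colimit.ι_desc _ _

omit gen in
/-- `Spec B → Spec ℤ[t]`. [folklore] -/
abbrev sB : Spec (CommRingCat.of B) ⟶ Spec (CommRingCat.of (A t)) :=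
  Spec.map (CommRingCat.ofHom (A t).val.toRingHom)

/-- **`ψ_S ≫ pt = V_S.ι ≫ g ≫ (Spec B → Spec ℤ[t])`**: on `V_S` the structure maps agree (both are
`Spec` of `ℤ[t] → B → Γ(Y, 𝒪) → Γ(Y, V_S)`). [folklore] -/
theorem ψ_pt (S : NIdx n) : ψ g V gen t S ≫ pt g V gen t = (VS V S).ι ≫ g ≫ sB t := by
  rw [ψ, Category.assoc, ι_pt, u, Category.assoc, ← Spec.map_comp]
  have e : CommRingCat.ofHom (toCS g V gen t S).toRingHom ≫ CommRingCat.ofHom (CS g V gen t S).val.toRingHom =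
      CommRingCat.ofHom (A t).val.toRingHom ≫ (CommRingCat.ofHom (algebraMapΓ g) ≫
        Y.presheaf.map (homOfLE (le_top : VS V S ≤ ⊤)).op) := by
    ext b; rfl
  rw [e, Spec.map_comp, Spec.map_comp, ← Category.assoc, ← Category.assoc,
    Scheme.Opens.toSpecΓ_SpecMap_presheaf_map_top, Category.assoc, Category.assoc,
    ← Category.assoc Y.toSpecΓ, Morphisms.ZariskiProj.toSpecΓ_SpecMap_algebraMapΓ]

/-- **`Ψ ≫ pt = g ≫ (Spec B → Spec ℤ[t])`.** [folklore] -/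
theorem Ψ_pt : Ψ g V gen t hV ≫ pt g V gen t = g ≫ sB t := by
  refine Scheme.Cover.hom_ext (chartCover V hV) _ _ fun i => ?_
  rw [← Category.assoc, chartCover_f, ι_Ψ_single, ψ_pt]

/-- **`jY : Y → Y_t ×_{ℤ[t]} Spec B`**, a morphism over `Spec B`. [folklore] -/
def jY : Y ⟶ pullback (pt g V gen t) (sB t) :=
  pullback.lift (Ψ g V gen t hV) g (Ψ_pt g V gen t hV)

/-- `jY` followed by the first projection is `Ψ`. [folklore] -/
@[simp] theorem jY_fst : jY g V gen t hV ≫ pullback.fst _ _ = Ψ g V gen t hV := pullback.lift_fst _ _ _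

/-- `jY` followed by the second projection is `g`. [folklore] -/
@[simp] theorem jY_snd : jY g V gen t hV ≫ pullback.snd _ _ = g := pullback.lift_snd _ _ _

variable (d : ∀ i j : Fin n, Finset Γ(Y, (V i : Y.Opens)))
  (hd : ∀ i j, (V i : Y.Opens) ⊓ V j = (d i j).sup fun f => Y.basicOpen f)
  (hgood : ∀ (S T : NIdx n) (hST : S ≤ T), ∃ hmem : ∀ f : hfam g V d S T, (f.1 : C g V T) ∈ CS g V gen t T,
      IsOpenImmersion ((F g V gen t).map (homOfLE hST)) ∧
        Set.range ((F g V gen t).map (homOfLE hST)) =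
          ⋃ f : hfam g V d S T, (PrimeSpectrum.basicOpen (⟨f.1, hmem f⟩ : CS g V gen t T) :
            Set (PrimeSpectrum (CS g V gen t T))))

include hd hgood in
/-- **Conversely, a point of `Y` mapping into the chart `U_S` lies in `V_S`**: it lies in some `V_i`, the
images of `u_i y` and of the chart of `S` agree in `Y_t`, hence come from a common `Spec ℤ[t][G K]`,
`K ≤ S, {i}` (`ι_eq_ι_iff`, local directedness), so `u_i y ∈ D(h)` for some `h ∈ hfam K {i}` (the image of
the transition map), and `y ∈ D(h) ⊆ V_K ⊆ V_S`. [folklore] -/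
theorem mem_VS_of_Ψ_apply_mem (S : NIdx n) {y : Y}
    (hy : Ψ g V gen t hV y ∈ (colimit.ι (F g V gen t) S).opensRange) : y ∈ VS V S := by
  obtain ⟨i, hi⟩ := exists_mem_VS_single V hV y
  -- `Ψ y = ι_i (u_i y)`
  have h := congrArg (fun φ => φ ⟨y, hi⟩)
    (congrArg (fun φ : (VS V (NIdx.single i)).toScheme ⟶ _ => (φ : _ → _)) (ι_Ψ_single g V gen t hV i))
  simp only [Scheme.Hom.comp_base, TopCat.coe_comp, Function.comp_apply] at h
  change Ψ g V gen t hV y = (u g V gen t (NIdx.single i) ≫ colimit.ι (F g V gen t) (NIdx.single i)) ⟨y, hi⟩ at h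
  rw [Scheme.Hom.comp_apply] at h
  obtain ⟨b, hb⟩ := hy
  rw [h] at hb
  obtain ⟨K, fS, fi, x, hxS, hxi⟩ := (Scheme.IsLocallyDirected.ι_eq_ι_iff (F g V gen t)).mp hb
  -- `u_i y ∈ im (F K → F {i}) = ⋃ D(h)`
  obtain ⟨hmem, -, hr⟩ := hgood K (NIdx.single i) fi.le
  have hmemr : u g V gen t (NIdx.single i) ⟨y, hi⟩ ∈ Set.range ((F g V gen t).map (homOfLE fi.le)) := by
    rw [Subsingleton.elim (homOfLE fi.le) fi]; exact ⟨x, hxi⟩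
  rw [hr] at hmemr
  obtain ⟨f, hf⟩ := Set.mem_iUnion.mp hmemr
  have hy' : (⟨y, hi⟩ : (VS V (NIdx.single i)).toScheme) ∈
      u g V gen t (NIdx.single i) ⁻¹ᵁ PrimeSpectrum.basicOpen (⟨f.1, hmem f⟩ : CS g V gen t (NIdx.single i)) := hf
  rw [u_preimage_basicOpen] at hy'
  have hyD : y ∈ Y.basicOpen ((f.1 : C g V (NIdx.single i)) : Γ(Y, VS V (NIdx.single i))) := hy'
  exact VS_mono V fS.le (basicOpen_le_VS g V d hd fi.le f.2 hyD)

include hd hgood in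
/-- **`Ψ⁻¹(U_S) = V_S`.** [folklore] -/
theorem Ψ_preimage_opensRange (S : NIdx n) :
    Ψ g V gen t hV ⁻¹ᵁ (colimit.ι (F g V gen t) S).opensRange = VS V S := by
  ext y
  exact ⟨fun hy => mem_VS_of_Ψ_apply_mem g V gen t hV d hd hgood S hy, fun hy => Ψ_apply_mem g V gen t hV S hy⟩


omit hOI hLD in
/-- On global sections, `u_S` sends `y ∈ ℤ[t][G S]` to `y|` viewed in `Γ(V_S, 𝒪_{V_S})`. [folklore] -/
theorem u_appTop_apply (S : NIdx n) (y : CS g V gen t S) :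
    (u g V gen t S).appTop ((Scheme.ΓSpecIso (CommRingCat.of (CS g V gen t S))).inv y) =
      (VS V S).topIso.inv (y.1 : Γ(Y, VS V S)) := by
  have h1 : (Spec.map (CommRingCat.ofHom (CS g V gen t S).val.toRingHom)).appTop
      ((Scheme.ΓSpecIso (CommRingCat.of (CS g V gen t S))).inv y) =
      (Scheme.ΓSpecIso (CommRingCat.of (C g V S))).inv (y.1) := by
    change ((Scheme.ΓSpecIso (CommRingCat.of (CS g V gen t S))).inv ≫ (Spec.map (CommRingCat.ofHom
      (CS g V gen t S).val.toRingHom)).appTop) y = (CommRingCat.ofHom (CS g V gen t S).val.toRingHom ≫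
        (Scheme.ΓSpecIso (CommRingCat.of (C g V S))).inv) y
    rw [Scheme.ΓSpecIso_inv_naturality]
  have h2 : (VS V S).toSpecΓ.appTop ((Scheme.ΓSpecIso (CommRingCat.of (C g V S))).inv (y.1)) =
      (VS V S).topIso.inv (y.1 : Γ(Y, VS V S)) := by
    rw [Scheme.Opens.toSpecΓ_appTop, CommRingCat.comp_apply]
    change (VS V S).topIso.inv ((Scheme.ΓSpecIso Γ(Y, VS V S)).hom ((Scheme.ΓSpecIso Γ(Y, VS V S)).inv _)) = _
    rw [Iso.inv_hom_id_apply]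
  rw [u, Scheme.Hom.comp_appTop, CommRingCat.comp_apply]
  exact (congrArg (fun z => (VS V S).toSpecΓ.appTop z) h1).trans h2

omit gen t hOI hLD in
/-- On global sections, `V_S.ι ≫ g` sends `b ∈ B` to the structure scalar `b · 1 ∈ Γ(V_S, 𝒪)`. [folklore] -/
theorem ι_appTop_algebraMapΓ (S : NIdx n) (b : B) :
    (VS V S).ι.appTop (g.appTop ((Scheme.ΓSpecIso (CommRingCat.of B)).inv b)) =
      (VS V S).topIso.inv (algebraMap B (C g V S) b) := by
  rw [Scheme.Opens.ι_appTop, Sections.algebraMap_apply]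
  change Y.presheaf.map _ (algebraMapΓ g b) = Y.presheaf.map _ (Y.presheaf.map _ (algebraMapΓ g b))
  exact (presheaf_map_map _ _ _ _).symm

/-! ## `jY` is a closed immersion -/

variable (hgen : ∀ i, Algebra.adjoin B (↑(gen i) : Set (Sections g (V i : Y.Opens))) = ⊤)

include hd hgood hgen in
/-- **`jY : Y → Y_t ×_{ℤ[t]} Spec B` is a closed immersion.** Checked on the affine open cover of the target
by the `W_S = Spec ℤ[t][G S] ×_{ℤ[t]} Spec B`: the source `jY⁻¹(W_S)` is `V_S` (`Ψ⁻¹(U_S) = V_S`), affine,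
and `Γ(W_S) → Γ(V_S)` is onto since `Γ(Y, V_S)` is generated over `B` by `G S ⊆ ℤ[t][G S]`
(`adjoin_G_eq_top`), the images of `ℤ[t][G S]` and of `B` factoring through `Γ(W_S)`.
[cite: StacksProject, Tag 01ZA/09ZP (Limits of Schemes), scheme-theoretic image form] -/
theorem isClosedImmersion_jY [IsSeparated g] : IsClosedImmersion (jY g V gen t hV) := by
  haveI := isSeparated_of g
  let 𝒲 := Scheme.Pullback.openCoverOfLeft (Scheme.IsLocallyDirected.openCover (F g V gen t))
    (pt g V gen t) (sB t)
  rw [IsZariskiLocalAtTarget.iff_of_openCover (P := @IsClosedImmersion) 𝒲]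
  intro S
  change IsClosedImmersion (pullback.snd (jY g V gen t hV) (𝒲.f S))
  -- notation: `W = Spec ℤ[t][G S] ×_{ℤ[t]} Spec B`, `Q = jY⁻¹ W`
  let fW := pullback.fst (colimit.ι (F g V gen t) S ≫ pt g V gen t) (sB t)
  let sW := pullback.snd (colimit.ι (F g V gen t) S ≫ pt g V gen t) (sB t)
  let q₁ := pullback.fst (jY g V gen t hV) (𝒲.f S)
  let q₂ := pullback.snd (jY g V gen t hV) (𝒲.f S)
  have hWf : 𝒲.f S ≫ pullback.fst (pt g V gen t) (sB t) = fW ≫ colimit.ι (F g V gen t) S :=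
    pullback.lift_fst _ _ _
  have hWs : 𝒲.f S ≫ pullback.snd (pt g V gen t) (sB t) = sW := by
    simp only [𝒲, Scheme.Pullback.openCoverOfLeft_f, pullback.lift_snd, Category.comp_id]
    rfl
  -- `Q ≅ V_S`
  have hrange : Set.range q₁ = Set.range (VS V S).ι := by
    change Set.range (pullback.fst (jY g V gen t hV) (𝒲.f S)) = _
    rw [Scheme.Pullback.range_fst, Scheme.Opens.range_ι]
    simp only [𝒲, Scheme.Pullback.openCoverOfLeft_f, Scheme.IsLocallyDirected.openCover_f]
    erw [Scheme.Pullback.range_map]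
    have e1 : (pullback.snd (pt g V gen t) (sB t)) ⁻¹' Set.range (𝟙 (Spec (CommRingCat.of B))) = Set.univ :=
      Set.eq_univ_of_forall fun z => ⟨pullback.snd (pt g V gen t) (sB t) z, rfl⟩
    rw [e1, Set.inter_univ, ← Set.preimage_comp]
    have e2 : ((pullback.fst (pt g V gen t) (sB t)) ∘ (jY g V gen t hV) : Y → _) = Ψ g V gen t hV := by
      funext y
      change (jY g V gen t hV ≫ pullback.fst _ _) y = _
      rw [jY_fst]
    rw [e2]
    exact congrArg SetLike.coe (Ψ_preimage_opensRange g V gen t hV d hd hgood S)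
  let eQ := IsOpenImmersion.isoOfRangeEq q₁ (VS V S).ι hrange
  have heQ : eQ.hom ≫ (VS V S).ι = q₁ := IsOpenImmersion.isoOfRangeEq_hom_fac _ _ _
  haveI : IsAffine (VS V S).toScheme := isAffineOpen_VS V S
  haveI : IsAffine (pullback (jY g V gen t hV) (𝒲.f S)) := IsAffine.of_isIso eQ.hom
  -- the two projections of `Q → W`
  have E1 : q₂ ≫ fW = eQ.hom ≫ u g V gen t S := by
    rw [← cancel_mono (colimit.ι (F g V gen t) S), Category.assoc, Category.assoc, ← hWf,
      ← Category.assoc q₂]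
    change (pullback.snd (jY g V gen t hV) (𝒲.f S) ≫ 𝒲.f S) ≫ _ = _
    rw [← pullback.condition, Category.assoc, jY_fst]
    change q₁ ≫ _ = _
    rw [← heQ, Category.assoc, ι_Ψ, ψ]
  have E2 : q₂ ≫ sW = eQ.hom ≫ (VS V S).ι ≫ g := by
    rw [← hWs, ← Category.assoc]
    change (pullback.snd (jY g V gen t hV) (𝒲.f S) ≫ 𝒲.f S) ≫ _ = _
    rw [← pullback.condition, Category.assoc, jY_snd]
    change q₁ ≫ g = _
    rw [← heQ, Category.assoc]
  -- surjectivity on global sections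
  have hsurj : Function.Surjective q₂.appTop := by
    let Θ : Γ(Y, VS V S) →+* Γ(pullback (jY g V gen t hV) (𝒲.f S), ⊤) :=
      eQ.hom.appTop.hom.comp (VS V S).topIso.inv.hom
    have hΘ : Function.Surjective Θ :=
      (ConcreteCategory.bijective_of_isIso eQ.hom.appTop).2.comp
        (ConcreteCategory.bijective_of_isIso (VS V S).topIso.inv).2
    intro z
    obtain ⟨c, rfl⟩ := hΘ z
    suffices H : ∀ c : C g V S, c ∈ Algebra.adjoin B (G g V gen S) → ∃ a, q₂.appTop a = Θ c from
      H c (by rw [adjoin_G_eq_top g V gen hgen S]; exact Algebra.mem_top)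
    intro c hc
    induction hc using Algebra.adjoin_induction with
    | mem x hx =>
      let v := (Scheme.ΓSpecIso (CommRingCat.of (CS g V gen t S))).inv ⟨x, Stage.subset_stage _ _ hx⟩
      refine ⟨fW.appTop v, ?_⟩
      have key := congrArg Scheme.Hom.appTop E1
      rw [Scheme.Hom.comp_appTop, Scheme.Hom.comp_appTop] at key
      have key' : q₂.appTop (fW.appTop v) = eQ.hom.appTop ((u g V gen t S).appTop v) :=
        DFunLike.congr_fun (congrArg CommRingCat.Hom.hom key) v
      exact key'.trans (congrArg (fun z => eQ.hom.appTop z) (u_appTop_apply g V gen t S ⟨x, _⟩))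
    | algebraMap b =>
      let v := (Scheme.ΓSpecIso (CommRingCat.of B)).inv b
      refine ⟨sW.appTop v, ?_⟩
      have key := congrArg Scheme.Hom.appTop E2
      rw [Scheme.Hom.comp_appTop, Scheme.Hom.comp_appTop, Scheme.Hom.comp_appTop] at key
      have key' : q₂.appTop (sW.appTop v) = eQ.hom.appTop ((VS V S).ι.appTop (g.appTop v)) :=
        DFunLike.congr_fun (congrArg CommRingCat.Hom.hom key) v
      exact key'.trans (congrArg (fun z => eQ.hom.appTop z) (ι_appTop_algebraMapΓ g V S b))
    | add x y _ _ hx hy =>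
      obtain ⟨a, ha⟩ := hx
      obtain ⟨a', ha'⟩ := hy
      exact ⟨a + a', by rw [map_add, map_add, ha, ha']⟩
    | mul x y _ _ hx hy =>
      obtain ⟨a, ha⟩ := hx
      obtain ⟨a', ha'⟩ := hy
      exact ⟨a * a', by rw [map_mul, map_mul, ha, ha']⟩
  haveI : IsAffine ((F g V gen t).obj S) := inferInstanceAs (IsAffine (Spec _))
  haveI : IsAffine (𝒲.X S) :=
    inferInstanceAs (IsAffine (pullback (colimit.ι (F g V gen t) S ≫ pt g V gen t) (sB t)))
  exact IsClosedImmersion.of_surjective_of_isAffine _ hsurj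

end Model

end FTModel

end Literature.AlgebraicGeometry.Limits

end

/-!
# Part 5. Noetherian base, finite type, quasi-compactness, separatedness; existence

Part 5 (properties of the model; existence). Properties of the model
`Y_t = colim F t → Spec ℤ[t]` of a separated `B`-scheme of finite type at a good stage:

* `isNoetherianRing_A` — `ℤ[t]` is Noetherian (a finitely generated `ℤ`-algebra);
* `locallyOfFiniteType_pt`, `compactSpace_colimit` — `Y_t → Spec ℤ[t]` is of finite type;
* `isSeparated_pt` — **`Y_t → Spec ℤ[t]` is separated**: its diagonal is a closed immersion over the affine
  charts `Spec ℤ[t][G S] ×_{ℤ[t]} Spec ℤ[t][G S']`, where its source is `Spec ℤ[t][G (S ∪ S')]` (local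
  directedness) and `ℤ[t][G S] ⊗ ℤ[t][G S'] → ℤ[t][G (S ∪ S')]` is onto, the generators `G (S ∪ S')` being
  restrictions of those of `G S`, `G S'`;
* `exists_finiteTypeModel` — **for every separated `B`-scheme `Y → Spec B` of finite type there are a
  Noetherian (finitely generated) ring `A₀ → B`, a separated `A₀`-scheme `Y₀ → Spec A₀` of finite type and a
  closed `B`-immersion `Y ↪ Y₀ ×_{A₀} Spec B`** — The Stacks Project, Tags 01ZA/09ZP/0A0Q for `S = Spec B`,
  in scheme-theoretic image form (no limit presentation is asserted).

Everything is proved; no named facts.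

## References

* The Stacks Project, Tags 01ZA, 09ZP, 0A0Q (Limits of Schemes). [StacksProject]
* U. Görtz, T. Wedhorn, *Algebraic Geometry I*, 2nd ed. (2020), (10.13), Thm. 10.57, Thm. 10.63, Prop. 9.15.
  [GortzWedhorn2020]
* A. Grothendieck, J. Dieudonné, EGA IV₃ (1966), Thm. 8.8.2, 8.10.5.
-/

noncomputable section

universe u

open CategoryTheory CategoryTheory.Limits AlgebraicGeometry TopologicalSpace Opposite Filter
open Literature.AlgebraicGeometry.Morphisms (Sections algebraMapΓ)

namespace Literature.AlgebraicGeometry.Limits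

namespace FTModel

set_option backward.isDefEq.respectTransparency false

variable {B : Type u} [CommRing B] {Y : Scheme.{u}} (g : Y ⟶ Spec (.of B)) {n : ℕ}
  (V : Fin n → Y.affineOpens) (gen : ∀ i : Fin n, Finset (Sections g (V i : Y.Opens)))
  (t : Finset B)

/-! ## The base ring `ℤ[t]` and the charts are of finite type -/

omit g V gen in
/-- `ℤ[t]` is a Noetherian ring. [folklore] -/
theorem isNoetherianRing_A : IsNoetherianRing (A t) :=
  isNoetherianRing_of_fg (Subalgebra.fg_adjoin_finset t)

/-- `ℤ[t][G S]` is of finite type over `ℤ`. [folklore] -/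
theorem finiteType_CS (S : NIdx n) : Algebra.FiniteType ℤ (CS g V gen t S) := by
  rw [← Subalgebra.fg_iff_finiteType]
  refine ⟨(((Finset.finite_toSet t).image (algebraMap B (C g V S))).union (G_finite g V gen S)).toFinset, ?_⟩
  rw [Set.Finite.coe_toFinset]
  rfl

/-- `ℤ[t] → ℤ[t][G S]` is of finite type. [folklore] -/
theorem finiteType_toCS (S : NIdx n) : (toCS g V gen t S).toRingHom.FiniteType := by
  letI : Algebra (A t) (CS g V gen t S) := (toCS g V gen t S).toRingHom.toAlgebra
  haveI := finiteType_CS g V gen t S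
  exact Algebra.FiniteType.of_restrictScalars_finiteType ℤ (A t) (CS g V gen t S)

section Model

variable [hOI : ∀ {S T : NIdx n} (f : S ⟶ T), IsOpenImmersion ((F g V gen t).map f)]
  [hLD : ((F g V gen t) ⋙ Scheme.forget).IsLocallyDirected]

/-- `Y_t → Spec ℤ[t]` is locally of finite type. [folklore] -/
theorem locallyOfFiniteType_pt : LocallyOfFiniteType (pt g V gen t) := by
  rw [IsZariskiLocalAtSource.iff_of_openCover (P := @LocallyOfFiniteType)
    (Scheme.IsLocallyDirected.openCover (F g V gen t))]
  intro S
  rw [Scheme.IsLocallyDirected.openCover_f, ι_pt, HasRingHomProperty.Spec_iff (P := @LocallyOfFiniteType)]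
  exact finiteType_toCS g V gen t S

/-- `Y_t` is quasi-compact. [folklore] -/
theorem compactSpace_colimit : CompactSpace ↥(colimit (F g V gen t)) := by
  haveI : ∀ S, CompactSpace ((Scheme.IsLocallyDirected.openCover (F g V gen t)).X S) := fun S =>
    inferInstanceAs (CompactSpace (PrimeSpectrum (CS g V gen t S)))
  haveI : Finite (Scheme.IsLocallyDirected.openCover (F g V gen t)).I₀ := inferInstanceAs (Finite (NIdx n))
  exact Scheme.OpenCover.compactSpace (Scheme.IsLocallyDirected.openCover (F g V gen t))

/-- `Y_t → Spec ℤ[t]` is quasi-compact. [folklore] -/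
theorem quasiCompact_pt : QuasiCompact (pt g V gen t) := by
  haveI := compactSpace_colimit g V gen t
  exact (HasAffineProperty.iff_of_isAffine (P := @QuasiCompact)).mpr ‹_›

/-! ## `Y_t → Spec ℤ[t]` is separated -/

omit hOI hLD in
/-- `(Spec φ).appTop ((ΓSpecIso R).inv x) = (ΓSpecIso S).inv (φ x)`. [folklore] -/
theorem specMap_appTop_ΓSpecIso_inv {R S : CommRingCat.{u}} (φ : R ⟶ S) (x : R) :
    (Spec.map φ).appTop ((Scheme.ΓSpecIso R).inv x) = (Scheme.ΓSpecIso S).inv (φ x) := by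
  change ((Scheme.ΓSpecIso R).inv ≫ (Spec.map φ).appTop) x = (φ ≫ (Scheme.ΓSpecIso S).inv) x
  rw [Scheme.ΓSpecIso_inv_naturality]

/-- **`U_S ∩ U_{S'} = U_{S ∪ S'}`**: the comparison `Spec ℤ[t][G (S ∪ S')] → U_S ×_{Y_t} U_{S'}` is an
isomorphism — an open immersion (its composite with the first projection is the transition map) onto
(two chart points with the same image in `Y_t` come from a common `Spec ℤ[t][G K]`, `K ≤ S, S'`, by local
directedness, hence from `Spec ℤ[t][G (S ∪ S')]`). [folklore] -/
theorem isIso_lift_inter (S S' : NIdx n) :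
    IsIso (pullback.lift ((F g V gen t).map (homOfLE (NIdx.inter_le_left S S')))
      ((F g V gen t).map (homOfLE (NIdx.inter_le_right S S')))
      ((colimit.w (F g V gen t) (homOfLE (NIdx.inter_le_left S S'))).trans
        (colimit.w (F g V gen t) (homOfLE (NIdx.inter_le_right S S'))).symm) :
      (F g V gen t).obj (NIdx.inter S S') ⟶
        pullback (colimit.ι (F g V gen t) S) (colimit.ι (F g V gen t) S')) := by
  set w := pullback.lift ((F g V gen t).map (homOfLE (NIdx.inter_le_left S S')))
      ((F g V gen t).map (homOfLE (NIdx.inter_le_right S S')))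
      ((colimit.w (F g V gen t) (homOfLE (NIdx.inter_le_left S S'))).trans
        (colimit.w (F g V gen t) (homOfLE (NIdx.inter_le_right S S'))).symm) with hw
  have hw1 : w ≫ pullback.fst _ _ = (F g V gen t).map (homOfLE (NIdx.inter_le_left S S')) :=
    pullback.lift_fst _ _ _
  have hw2 : w ≫ pullback.snd _ _ = (F g V gen t).map (homOfLE (NIdx.inter_le_right S S')) :=
    pullback.lift_snd _ _ _
  haveI : IsOpenImmersion (w ≫ pullback.fst (colimit.ι (F g V gen t) S) (colimit.ι (F g V gen t) S')) := by
    rw [hw1]; infer_instance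
  haveI : IsOpenImmersion w := IsOpenImmersion.of_comp w (pullback.fst _ _)
  -- onto
  have hsurj : Function.Surjective w := by
    intro z
    have hz : colimit.ι (F g V gen t) S (pullback.fst (colimit.ι (F g V gen t) S) (colimit.ι (F g V gen t) S') z) =
        colimit.ι (F g V gen t) S' (pullback.snd (colimit.ι (F g V gen t) S) (colimit.ι (F g V gen t) S') z) := by
      rw [← Scheme.Hom.comp_apply, ← Scheme.Hom.comp_apply, pullback.condition]
    obtain ⟨K, fS, fS', x, hxS, hxS'⟩ := (Scheme.IsLocallyDirected.ι_eq_ι_iff (F g V gen t)).mp hz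
    have hK : K ≤ NIdx.inter S S' := NIdx.le_inter fS.le fS'.le
    refine ⟨(F g V gen t).map (homOfLE hK) x, ?_⟩
    apply (pullback.fst (colimit.ι (F g V gen t) S) (colimit.ι (F g V gen t) S') ≫
      colimit.ι (F g V gen t) S).isOpenEmbedding.injective
    have e : (F g V gen t).map (homOfLE hK) ≫ w ≫ pullback.fst (colimit.ι (F g V gen t) S) (colimit.ι (F g V gen t) S') ≫
        colimit.ι (F g V gen t) S = (F g V gen t).map fS ≫ colimit.ι (F g V gen t) S := by
      rw [← Category.assoc w, hw1, ← Category.assoc, ← Functor.map_comp,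
        Subsingleton.elim (homOfLE hK ≫ homOfLE (NIdx.inter_le_left S S')) fS]
    change (pullback.fst _ _ ≫ colimit.ι (F g V gen t) S) (w (((F g V gen t).map (homOfLE hK)) x)) =
      (pullback.fst _ _ ≫ colimit.ι (F g V gen t) S) z
    rw [← Scheme.Hom.comp_apply, ← Scheme.Hom.comp_apply, e, Scheme.Hom.comp_apply, Scheme.Hom.comp_apply, hxS]
  haveI : Epi w.base := (TopCat.epi_iff_surjective _).mpr hsurj
  exact IsOpenImmersion.isIso w

/-- **The diagonal of `Y_t → Spec ℤ[t]` is a closed immersion over the chart `U_S ×_{ℤ[t]} U_{S'}`.** Its base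
change to the chart is `U_S ∩ U_{S'} = Spec ℤ[t][G (S ∪ S')] → U_S ×_{ℤ[t]} U_{S'}`
(Mathlib `pullback_map_diagonal_isPullback`, `isIso_lift_inter`), a morphism of affine schemes which is onto
on global sections: `ℤ[t][G (S ∪ S')]` is generated by `t` (coming from `ℤ[t]`) and by `G (S ∪ S')`, whose
members are restrictions of members of `G S` or of `G S'`. [folklore] -/
theorem isClosedImmersion_diagonal_chart (S S' : NIdx n) :
    IsClosedImmersion (pullback.snd (pullback.diagonal (pt g V gen t))
      (pullback.map (colimit.ι (F g V gen t) S ≫ pt g V gen t) (colimit.ι (F g V gen t) S' ≫ pt g V gen t)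
        (pt g V gen t) (pt g V gen t) (colimit.ι (F g V gen t) S) (colimit.ι (F g V gen t) S') (𝟙 _)
        (Category.comp_id _) (Category.comp_id _))) := by
  have sq := pullback_map_diagonal_isPullback (colimit.ι (F g V gen t) S) (colimit.ι (F g V gen t) S')
    (pt g V gen t)
  rw [(Iso.eq_inv_comp sq.isoPullback).mpr sq.isoPullback_hom_snd,
    MorphismProperty.cancel_left_of_respectsIso @IsClosedImmersion]
  -- notation
  haveI := isIso_lift_inter g V gen t S S'
  set w := pullback.lift ((F g V gen t).map (homOfLE (NIdx.inter_le_left S S')))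
      ((F g V gen t).map (homOfLE (NIdx.inter_le_right S S')))
      ((colimit.w (F g V gen t) (homOfLE (NIdx.inter_le_left S S'))).trans
        (colimit.w (F g V gen t) (homOfLE (NIdx.inter_le_right S S'))).symm) with hw
  set m := pullback.map (colimit.ι (F g V gen t) S) (colimit.ι (F g V gen t) S')
      (colimit.ι (F g V gen t) S ≫ pt g V gen t) (colimit.ι (F g V gen t) S' ≫ pt g V gen t) (𝟙 _) (𝟙 _)
      (pt g V gen t) (Category.id_comp _).symm (Category.id_comp _).symm with hm
  rw [← MorphismProperty.cancel_left_of_respectsIso @IsClosedImmersion w]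
  let K := NIdx.inter S S'
  let fT := pullback.fst (colimit.ι (F g V gen t) S ≫ pt g V gen t) (colimit.ι (F g V gen t) S' ≫ pt g V gen t)
  let sT := pullback.snd (colimit.ι (F g V gen t) S ≫ pt g V gen t) (colimit.ι (F g V gen t) S' ≫ pt g V gen t)
  have E1 : (w ≫ m) ≫ fT =
      Spec.map (CommRingCat.ofHom (resCS g V gen t (NIdx.inter_le_left S S')).toRingHom) := by
    rw [Category.assoc, hm, pullback.lift_fst, ← Category.assoc, hw, pullback.lift_fst, Category.comp_id]
    rfl
  have E2 : (w ≫ m) ≫ sT =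
      Spec.map (CommRingCat.ofHom (resCS g V gen t (NIdx.inter_le_right S S')).toRingHom) := by
    rw [Category.assoc, hm, pullback.lift_snd, ← Category.assoc, hw, pullback.lift_snd, Category.comp_id]
    rfl
  have E0 : (w ≫ m) ≫ fT ≫ colimit.ι (F g V gen t) S ≫ pt g V gen t =
      Spec.map (CommRingCat.ofHom (toCS g V gen t K).toRingHom) := by
    rw [← Category.assoc, E1, ← F_map g V gen t (homOfLE (NIdx.inter_le_left S S')), ← Category.assoc,
      colimit.w, ι_pt]
  -- surjectivity on global sections
  have hsurj : Function.Surjective (w ≫ m).appTop := by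
    intro z
    obtain ⟨x, rfl⟩ := (ConcreteCategory.bijective_of_isIso
      (Scheme.ΓSpecIso (CommRingCat.of (CS g V gen t K))).inv).2 z
    obtain ⟨x, hx⟩ := x
    induction hx using Algebra.adjoin_induction with
    | mem y hy =>
      rcases hy with ⟨b, hb, rfl⟩ | hy
      · -- `b ∈ t`, coming from `ℤ[t]`
        refine ⟨(fT ≫ colimit.ι (F g V gen t) S ≫ pt g V gen t).appTop
          ((Scheme.ΓSpecIso (CommRingCat.of (A t))).inv ⟨b, Algebra.subset_adjoin hb⟩), ?_⟩
        have key := congrArg Scheme.Hom.appTop E0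
        rw [Scheme.Hom.comp_appTop] at key
        have key' : (w ≫ m).appTop ((fT ≫ colimit.ι (F g V gen t) S ≫ pt g V gen t).appTop
            ((Scheme.ΓSpecIso (CommRingCat.of (A t))).inv ⟨b, Algebra.subset_adjoin hb⟩)) =
            (Spec.map (CommRingCat.ofHom (toCS g V gen t K).toRingHom)).appTop
              ((Scheme.ΓSpecIso (CommRingCat.of (A t))).inv ⟨b, Algebra.subset_adjoin hb⟩) :=
          DFunLike.congr_fun (congrArg CommRingCat.Hom.hom key) _
        rw [key', specMap_appTop_ΓSpecIso_inv]
        rfl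
      · -- `y ∈ G (S ∪ S')`, a restriction from `G S` or `G S'`
        obtain ⟨i, hi, z, hz, rfl⟩ : ∃ i, ∃ hi : i ∈ K.S, ∃ z ∈ (gen i : Set _), resV g V hi z = y := by
          simpa only [G, Set.mem_iUnion, Set.mem_image] using hy
        rcases Finset.mem_union.mp hi with hiS | hiS'
        · refine ⟨fT.appTop ((Scheme.ΓSpecIso (CommRingCat.of (CS g V gen t S))).inv
            ⟨resV g V hiS z, Stage.subset_stage _ _ (resV_mem_G g V gen hiS hz)⟩), ?_⟩
          have key := congrArg Scheme.Hom.appTop E1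
          rw [Scheme.Hom.comp_appTop] at key
          have key' : ∀ v, (w ≫ m).appTop (fT.appTop v) =
              (Spec.map (CommRingCat.ofHom (resCS g V gen t (NIdx.inter_le_left S S')).toRingHom)).appTop v :=
            fun v => DFunLike.congr_fun (congrArg CommRingCat.Hom.hom key) v
          rw [key', specMap_appTop_ΓSpecIso_inv]
          congr 1
          exact Subtype.ext (res_resV g V (NIdx.inter_le_left S S') hiS z)
        · refine ⟨sT.appTop ((Scheme.ΓSpecIso (CommRingCat.of (CS g V gen t S'))).inv
            ⟨resV g V hiS' z, Stage.subset_stage _ _ (resV_mem_G g V gen hiS' hz)⟩), ?_⟩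
          have key := congrArg Scheme.Hom.appTop E2
          rw [Scheme.Hom.comp_appTop] at key
          have key' : ∀ v, (w ≫ m).appTop (sT.appTop v) =
              (Spec.map (CommRingCat.ofHom (resCS g V gen t (NIdx.inter_le_right S S')).toRingHom)).appTop v :=
            fun v => DFunLike.congr_fun (congrArg CommRingCat.Hom.hom key) v
          rw [key', specMap_appTop_ΓSpecIso_inv]
          congr 1
          exact Subtype.ext (res_resV g V (NIdx.inter_le_right S S') hiS' z)
    | algebraMap r =>
      refine ⟨r, ?_⟩
      have e : (⟨algebraMap ℤ (C g V K) r, Subalgebra.algebraMap_mem _ r⟩ : CS g V gen t K) = (r : CS g V gen t K) :=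
        Subtype.ext (by simp)
      rw [e, map_intCast, map_intCast]
    | add x y _ _ hx hy =>
      obtain ⟨a, ha⟩ := hx
      obtain ⟨a', ha'⟩ := hy
      refine ⟨a + a', ?_⟩
      rw [map_add, ha, ha']
      exact (map_add ((Scheme.ΓSpecIso (CommRingCat.of (CS g V gen t K))).inv.hom) ⟨x, _⟩ ⟨y, _⟩).symm
    | mul x y _ _ hx hy =>
      obtain ⟨a, ha⟩ := hx
      obtain ⟨a', ha'⟩ := hy
      refine ⟨a * a', ?_⟩
      rw [map_mul, ha, ha']
      exact (map_mul ((Scheme.ΓSpecIso (CommRingCat.of (CS g V gen t K))).inv.hom) ⟨x, _⟩ ⟨y, _⟩).symm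
  haveI : IsAffine ((F g V gen t).obj S) := inferInstanceAs (IsAffine (Spec _))
  haveI : IsAffine ((F g V gen t).obj S') := inferInstanceAs (IsAffine (Spec _))
  haveI : IsAffine ((F g V gen t).obj K) := inferInstanceAs (IsAffine (Spec _))
  exact IsClosedImmersion.of_surjective_of_isAffine _ hsurj

/-- **`Y_t → Spec ℤ[t]` is separated**: its diagonal is a closed immersion over the open cover of
`Y_t ×_{ℤ[t]} Y_t` by the `U_S ×_{ℤ[t]} U_{S'}` (`isClosedImmersion_diagonal_chart`).
[cite: GortzWedhorn2020, Prop. 9.15; StacksProject, Tag 01KP] -/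
theorem isSeparated_pt : IsSeparated (pt g V gen t) := by
  refine ⟨IsZariskiLocalAtTarget.of_openCover (P := @IsClosedImmersion)
    (Scheme.Pullback.openCoverOfLeftRight (Scheme.IsLocallyDirected.openCover (F g V gen t))
      (Scheme.IsLocallyDirected.openCover (F g V gen t)) (pt g V gen t) (pt g V gen t)) fun SS' => ?_⟩
  exact isClosedImmersion_diagonal_chart g V gen t SS'.1 SS'.2

end Model

end FTModel

/-! ## Existence of finite type models -/

open FTModel in
/-- **Finite type models over a Noetherian subring.** For every separated morphism of finite type
`g : Y → Spec B` there are a finitely generated subring `A₀ = ℤ[t] ⊆ B` (Noetherian), a separated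
`A₀`-scheme `Y₀ → Spec A₀` of finite type and a closed `B`-immersion `Y ↪ Y₀ ×_{A₀} Spec B`. (`Y₀` is the
model `Y_t` glued from the `Spec ℤ[t][G S]` at a good stage `t`; The Stacks Project, Tags 01ZA/09ZP/0A0Q
for an affine base, in scheme-theoretic image form.)
[cite: StacksProject, Tag 09ZP/0A0Q (Limits of Schemes)] [cite: GortzWedhorn2020, Thm. 10.63 (p. 327)] -/
theorem exists_finiteTypeModel {B : Type u} [CommRing B] {Y : Scheme.{u}} (g : Y ⟶ Spec (.of B))
    [IsSeparated g] [LocallyOfFiniteType g] [QuasiCompact g] :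
    ∃ (A₀ : Type u) (_ : CommRing A₀) (φ : A₀ →+* B) (Y₀ : Scheme.{u}) (p : Y₀ ⟶ Spec (.of A₀))
      (j : Y ⟶ pullback p (Spec.map (CommRingCat.ofHom φ))),
      IsNoetherianRing A₀ ∧ Algebra.FiniteType ℤ A₀ ∧ Function.Injective φ ∧ IsSeparated p ∧
        LocallyOfFiniteType p ∧ QuasiCompact p ∧ IsClosedImmersion j ∧ j ≫ pullback.snd _ _ = g := by
  classical
  haveI : CompactSpace Y := QuasiCompact.compactSpace_of_compactSpace g
  haveI : Y.IsSeparated := isSeparated_of g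
  -- a finite affine open cover
  obtain ⟨tV, htV⟩ := Literature.AlgebraicGeometry.Modules.exists_finite_affineOpens_iSup_eq_top (X := Y)
  let e : ↥tV ≃ Fin tV.card := tV.equivFin
  let V : Fin tV.card → Y.affineOpens := fun i => (e.symm i).1
  have hV : ⨆ i, (V i : Y.Opens) = ⊤ := by
    rw [← htV]
    exact e.symm.iSup_comp (g := fun W : ↥tV => ((W : Y.affineOpens) : Y.Opens))
  -- finite generation of the `Γ(Y, V_i)` over `B`
  have hft : ∀ i, Algebra.FiniteType B (Sections g (V i : Y.Opens)) := fun i => by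
    have h := HasRingHomProperty.appLE @LocallyOfFiniteType (f := g) inferInstance ⟨⊤, isAffineOpen_top _⟩ (V i)
      (le_top.trans_eq (Opens.map_top g.base).symm)
    have h2 : RingHom.FiniteType ((g.appLE ⊤ (V i : Y.Opens) (le_top.trans_eq (Opens.map_top g.base).symm)).hom.comp
        (Scheme.ΓSpecIso (CommRingCat.of B)).inv.hom) :=
      h.comp (RingHom.FiniteType.of_surjective _ (ConcreteCategory.bijective_of_isIso _).2)
    have e3 : algebraMap B (Sections g (V i : Y.Opens)) =
        (g.appLE ⊤ (V i : Y.Opens) (le_top.trans_eq (Opens.map_top g.base).symm)).hom.comp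
          (Scheme.ΓSpecIso (CommRingCat.of B)).inv.hom :=
      RingHom.ext fun b => rfl
    rw [← RingHom.finiteType_algebraMap, e3]
    exact h2
  choose gen hgen using fun i => (hft i).out
  choose d hd using exists_d V
  -- a good stage
  obtain ⟨t, hdres, hgood⟩ := (eventually_good g V gen d hgen hd).exists
  haveI hOI : ∀ {S T : NIdx tV.card} (f : S ⟶ T), IsOpenImmersion ((F g V gen t).map f) := fun {S T} f => by
    obtain ⟨-, h, -⟩ := hgood S T f.le
    rwa [Subsingleton.elim (homOfLE f.le) f] at h
  haveI hLD := isLocallyDirected_of_good g V gen d t hdres hgood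
  refine ⟨A t, inferInstance, (A t).val.toRingHom, colimit (F g V gen t), pt g V gen t, jY g V gen t hV,
    isNoetherianRing_A t, (Subalgebra.fg_iff_finiteType _).mp (Subalgebra.fg_adjoin_finset t),
    Subtype.val_injective, isSeparated_pt g V gen t, locallyOfFiniteType_pt g V gen t, quasiCompact_pt g V gen t,
    isClosedImmersion_jY g V gen t hV d hd hgood hgen, jY_snd g V gen t hV⟩

end Literature.AlgebraicGeometry.Limits

end
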